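import Literature.NumberTheory.EllipticCurves.McCallum1991.KolyvaginLocalLeavesRingClassTowers
import Literature.NumberTheory.EllipticCurves.McCallum1991.KolyvaginLocalLeavesEigenparts
import Literature.NumberTheory.EllipticCurves.BSDSelmerPConverseSerreProofs
import Literature.NumberTheory.EllipticCurves.HeegnerPointsKolyvaginPrimaryProp82Proofs
import Literature.NumberTheory.EllipticCurves.McCallum1991.KolyvaginClassesLocalLeaves
import Literature.NumberTheory.EllipticCurves.HeegnerPointsOfConductorGaloisOrbitProofs
import Literature.NumberTheory.EllipticCurves.HeegnerPointReflectionHolds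
import Literature.NumberTheory.EllipticCurves.HeegnerPointsOfConductorRationalityProofs
import Literature.NumberTheory.EllipticCurves.GreenbergVatsal2000.ResidualSelmerGroups
import Literature.NumberTheory.EllipticCurves.RibetGoodLatticeExistsProofs
import Literature.NumberTheory.EllipticCurves.RingClassGalOverCardinality
import Literature.NumberTheory.EllipticCurves.RingClassGalOverCyclicProofs
import Literature.NumberTheory.GaloisCohomology.PoitouTateFiniteUnramifiedTransport
import Literature.NumberTheory.GaloisRepresentations.UnramifiedClassesInertia
import HarnessLib

/-!
# McCallum 1991 (Kolyvagin's work on Ш): the local leaves, 3/3 — Zhang–Gross inputs, the `τ`-eigen decomposition and the discharges of `prop22_reciprocity_eigen_finset`, `lemma53_selmer_eigen_dependent_at`, `sign_conjAct_kolyvaginClass` (re-homed proofs)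

**McCallum 1991 (Kolyvagin's work on Shafarevich–Tate groups): three of the local leaves of the Euler-system argument — the named facts
`Literature.NumberTheory.EllipticCurves.McCallum1991.prop22_reciprocity_eigen_finset` (Prop. 2.2: the reciprocity law pairing the localisations of the derived Kolyvagin classes on `τ`-eigen finite sets),
`…lemma53_selmer_eigen_dependent_at` (Lemma 5.3: Selmer eigen-classes are dependent at a Kolyvagin prime) and `…sign_conjAct_kolyvaginClass` (the sign of complex
conjugation on a Kolyvagin class), `KolyvaginClassesLocalLeaves.lean`, HOLD — EXACT names `…_holds`** ([McCallumLMS1991] W. McCallum, *Kolyvagin's work on Shafarevich–Tate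
groups*, LMS Lecture Notes 153 (1991), Prop. 2.2, Lemma 5.3, §4; [GrossLMS1991] B. Gross, *Kolyvagin's work on modular elliptic curves*, §§3–5; [Kolyvagin1991MathAnn]).
Contents: ring class towers over an imaginary quadratic field (Galois groups, total ramification, cyclicity, conjugation), Kolyvagin primes and their local shape, the
tame cup product and local triviality, unramified classes and inertia, Frobenius eigenparts and the `H⁴⁴`-type counting data, Heegner traces and the Zhang–Gross
formula inputs, the `τ`-eigen decomposition, conjugation on Kolyvagin classes, and the three discharges.
RE-HOMED into `Literature/` by the Hodge foundations lane (`lit-hodgefound`, seat p20, generation 40): verbatim DECLARATION-LEVEL ports (the 154 declarations needed, in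
dependency order; each Part is a slice of one Summits module) of 43 theorem modules `Summits/BirchSwinnertonDyer/BirchSwinnertonDyer/Theorems/KolyvaginDepthDoor*.lean`,
`Summits/BirchSwinnertonDyer/Rank1Residual/{X11b,GaloisImage,JET,X1,X2}/*.lean`; namespaces re-rooted at `Literature.NumberTheory.EllipticCurves.McCallum1991` (`….Theorems.KolyvaginDepthDoor` ↦ `.LeafProofs`,
`…X11b.Three.Koly.Method2` ↦ `.AuxPrimes`, `…X11b.<M>` ↦ `.<M>`), the local-triviality / unramified-cup lemmas joining `Literature.NumberTheory.GaloisCohomology.PoitouTateFinite.{LocBridge,GaloisImage}`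
and `…RibetGoodLattice.{CongruenceTransfer,TateLineDecomposition}` / `…GreenbergVatsal2000` where the tree already hosts their twins (21 identical tree lemmas are used, not
re-declared); the `_holds` theorems carry the EXACT names.  Theorem-only: no definition, no new named fact (D-0026); imports Mathlib/Literature only; every declaration carries
the citation of the printed statement it formalises or serves.  The Summits originals stay in place (transitional duplication).  WHAT THIS IS NOT: nothing here bears on BSD
for any curve; it is Kolyvagin–McCallum's local analysis in the tree's vocabulary.  (This is file 3 of 3.)
-/

noncomputable section

/-!
## Part 1 — port of `Summits/BirchSwinnertonDyer/BirchSwinnertonDyer/Theorems/KolyvaginDepthDoorKolyvaginDepthSupplyLeafReciprocityOfPoitouTate.lean` (1 declarations kept)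

# Kolyvagin's reciprocity (R)_M at a Kolyvagin place against Selmer classes vanishing on a finite set of further places, from Poitou–Tate

Declarations of this Part (verbatim port; each keeps its own docstring and citation): `kolyvaginReciprocityFinset_of_poitouTate_of_hasGoodReductionAt`.

Reference keys (see `references.bib` and the declarations' citations): [McCallumLMS1991], [GrossLMS1991], [MilneADT2006], [NeukirchANT1999].
-/

section Part1

open scoped _root_.Classical _root_.Pointwise

universe u

namespace Literature.NumberTheory.EllipticCurves.McCallum1991.LeafProofs

open _root_.WeierstrassCurve _root_.NumberField _root_.IsDedekindDomain _root_.Field _root_.Function ValuativeRel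
open Literature.NumberTheory.EllipticCurves Literature.NumberTheory.EllipticCurves.ModularForms
open Literature.NumberTheory.GaloisRepresentations
open Literature.NumberTheory.GaloisRepresentations.IsNonarchimedeanLocalField
open Literature.NumberTheory.GaloisCohomology
open Literature.NumberTheory.GaloisRepresentations.DiscreteGaloisModule (mu MuCarrier)
open Literature.NumberTheory.EllipticCurves.McCallum1991 Literature.NumberTheory.EllipticCurves.McCallum1991
open Literature.NumberTheory.EllipticCurves.McCallum1991.KolyvaginReciprocity

/-! ## (R)_M against Selmer classes vanishing on a finite set of places, from (PT)
theorem with the idle rank-one binders removed -/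

section Reciprocity

variable (N : ℕ) (W : WeierstrassCurve ℚ) (K : Type u) [Field K] [NumberField K]

/-- **Kolyvagin reciprocity (R)_M at a Kolyvagin prime against Selmer classes vanishing on a finite
set `T` of further places, from Poitou–Tate**
`KolyvaginReciprocity.kolyvaginReciprocityFinset_of_poitouTate` VERBATIM (statement and proof), with
its idle binders (`¬ CM`, `K` imaginary quadratic, `d_K ∉ {−3, −4}`, Heegner hypothesis,
non-torsion Heegner point, `p` odd, `ρ̄` onto, `Frob(ℓ) = Frob(∞)` modulo `p^M`) removed and good
reduction of `E/K` at `λ` (there read off the Heegner point) taken as the hypothesis `hgoodL`.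
CONDITIONAL on `hPT : poitouTate_sum_localTatePairing_eq_zero K` (a tree THEOREM for `K : Type`,
`poitouTate_sum_localTatePairing_eq_zero_holds`). For `E = W/ℚ` elliptic over the number field `K`,
`p` prime, `M ≥ 1`, `ℓ` a Kolyvagin prime (Gross (3.1)–(3.2)) with `λ` good: the Weil pairing `e`
on `E[p^M]` has
`e([s, F], [c', σ]) = 0` for every finite set `T` of finite places, every `s ∈ Sel_{p^M}(E/K)`
vanishing at the places of `T`, every `c'` Selmer at the finite places outside `T ∪ {λ}` and at
infinity, every prime `𝔔 ∣ λ`, arithmetic Frobenius `F` at `𝔔` fixing `E[p^M]`, and `σ ∈ I_𝔔`.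
[cite: McCallumLMS1991, §2 Prop. 2.2, §5 Lemma 5.3 and proof of Prop. 5.2]
[cite: GrossLMS1991, §7 (7.1), (7.6), Prop. 8.1 (2), Prop. 8.2, §9]
[cite: MilneADT2006, Ch. I Thm. 4.10(b), Cor. 2.3, Prop. 3.8] [cite: NeukirchANT1999, Ch. II §9 Prop. (9.6)] -/
theorem kolyvaginReciprocityFinset_of_poitouTate_of_hasGoodReductionAt
    (hPT : poitouTate_sum_localTatePairing_eq_zero K) [W.IsElliptic]
    {p : ℕ} (hp : p.Prime) {M : ℕ} (hM : 1 ≤ M)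
    {ℓ : ℕ} (hℓ : IsKolyvaginPrime N W K p ℓ)
    (hgoodL : (W.baseChange K).HasGoodReductionAt hℓ.place) :
    ∃ (A : Type u) (_ : AddCommGroup A)
      (e : geomTorsion (W.baseChange K) ((p ^ M : ℕ) : ℤ) →+
        geomTorsion (W.baseChange K) ((p ^ M : ℕ) : ℤ) →+ A),
      (∀ x, e x x = 0) ∧ (∀ x, (∀ y, e x y = 0) → x = 0) ∧
      ∀ (T : Finset (HeightOneSpectrum (𝓞 K))),
      ∀ s ∈ selmerGroup (W.baseChange K) ((p ^ M : ℕ) : ℤ),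
        (∀ v ∈ T, s ∈ (W.baseChange K).torsionLocalKer (v.adicCompletion K) ((p ^ M : ℕ) : ℤ)) →
        ∀ c' : galH1Torsion (W.baseChange K) ((p ^ M : ℕ) : ℤ),
        (∀ v : HeightOneSpectrum (𝓞 K), v ∉ T → (ℓ : 𝓞 K) ∉ v.asIdeal →
          c' ∈ selmerLocalKer (W.baseChange K) (v.adicCompletion K) ((p ^ M : ℕ) : ℤ)) →
        (∀ w : InfinitePlace K,
          c' ∈ selmerLocalKer (W.baseChange K) w.Completion ((p ^ M : ℕ) : ℤ)) →
        ∀ 𝔔 ∈ hℓ.place.primesAbove, ∀ F : Field.absoluteGaloisGroup K,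
          IsArithFrobAt (𝓞 K) F 𝔔 →
          F ∈ torsionFixing (W.baseChange K) ((p ^ M : ℕ) : ℤ) →
          ∀ σ ∈ 𝔔.inertia (Field.absoluteGaloisGroup K),
          e (h1Eval (W.baseChange K) ((p ^ M : ℕ) : ℤ) s F)
            (h1Eval (W.baseChange K) ((p ^ M : ℕ) : ℤ) c' σ) = 0 := by
  -- adapted from Summits/BirchSwinnertonDyer/Rank1Residual/X11b/KolyvaginReciprocityFinsetOfPoitouTate.lean
  -- proof verbatim with `hbad`/`hgood` read from `hgoodL`
  -- compactness of absolute Galois groups (cup products), as a local hypothesis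
  have _hΓc : ∀ (L : Type u) [Field L], CompactSpace (absoluteGaloisGroup L) :=
    fun L _ => absoluteGaloisGroup_compactSpace L
  haveI : NeZero (p ^ M) := ⟨pow_ne_zero _ hp.ne_zero⟩
  haveI : (W.baseChange K).IsElliptic := inferInstanceAs (W.map (algebraMap ℚ K)).IsElliptic
  have hq2 : 2 ≤ p ^ M := le_trans hp.two_le (Nat.le_self_pow (by omega) p)
  have hqK : ((p ^ M : ℕ) : K) ≠ 0 := Nat.cast_ne_zero.mpr (NeZero.ne (p ^ M))
  have hp0 : ((p ^ M : ℕ) : ℤ) ≠ 0 := by exact_mod_cast NeZero.ne (p ^ M)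
  -- the Weil pairing on `E[p^M]` over `K`
  obtain ⟨e, hμ, hadd₁, hadd₂, halt, hnondeg, hgal⟩ :=
    (W.baseChange K).exists_weilPairing_holds (p ^ M) hq2 hqK
  refine ⟨MuCarrier K (p ^ M), inferInstance,
    weilPairingHom (W.baseChange K) (p ^ M) e hμ hadd₁ hadd₂,
    weilPairingHom_self (W.baseChange K) (p ^ M) e hμ hadd₁ hadd₂ halt,
    TameCup.weilPairingHom_left_nondeg (W.baseChange K) (p ^ M) e hμ hadd₁ hadd₂ halt hnondeg, ?_⟩
  intro T s hs hsT c' hc'fin hc'inf 𝔔 h𝔔 F hF hFfix σ hσ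
  -- ### the family of local invariant maps of the Poitou–Tate fact at level `p^M`
  obtain ⟨inv, hperf, hsum⟩ := hPT (p ^ M)
  set lam := hℓ.place
  -- ### the finite set of places `S = {λ} ∪ T`
  set S : Finset (Place K) :=
    insert (Sum.inr lam) (T.map ⟨Sum.inr, Sum.inr_injective⟩) with hSdef
  have hmemS : Sum.inr lam ∈ S := Finset.mem_insert_self _ _
  -- ### local terms vanish off `S`: both classes satisfy the Kummer condition there (isotropy)
  have hsS : s ∈ ((W.baseChange K).kummerSelmerStructure ((p ^ M : ℕ) : ℤ)).selmerGroup := by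
    rw [← selmerGroup_eq_selmerGroup_kummerSelmerStructure]; exact hs
  have hloc_s : ∀ v : Place K, galoisCohomology.localization ((W.baseChange K).torsionGaloisModule ((p ^ M : ℕ) : ℤ)) v 1 s ∈
      (W.baseChange K).kummerSelmerStructure ((p ^ M : ℕ) : ℤ) v :=
    ((((W.baseChange K).kummerSelmerStructure ((p ^ M : ℕ) : ℤ)).mem_selmerGroup_iff s).mp hsS)
  have hloc_c' : ∀ v : Place K, v ∉ S →
      galoisCohomology.localization ((W.baseChange K).torsionGaloisModule ((p ^ M : ℕ) : ℤ)) v 1 c' ∈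
        (W.baseChange K).kummerSelmerStructure ((p ^ M : ℕ) : ℤ) v := by
    intro v hv
    have hmem : c' ∈ selmerLocalKer (W.baseChange K) (Place.Completion v) ((p ^ M : ℕ) : ℤ) := by
      rcases v with w | v
      · exact hc'inf w
      · refine hc'fin v (fun hT => hv ?_) (fun h => hv ?_)
        · exact Finset.mem_insert_of_mem (Finset.mem_map.mpr ⟨v, hT, rfl⟩)
        · rw [hℓ.mem_iff.mp h]
          exact hmemS
    rw [← (W.baseChange K).comap_localization_kummerSelmerStructure ((p ^ M : ℕ) : ℤ) v] at hmem
    exact hmem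
  have hS : ∀ v ∉ S,
      inv v ((weilContPairingLocal (W.baseChange K) (p ^ M) e hμ hadd₁ hadd₂ hgal v).cupProduct
        (galoisCohomology.localization ((W.baseChange K).torsionGaloisModule ((p ^ M : ℕ) : ℤ)) v 1 s)
        (galoisCohomology.localization ((W.baseChange K).torsionGaloisModule ((p ^ M : ℕ) : ℤ)) v 1 c')) = 0 := by
    intro v hv
    have h0 := (W.baseChange K).cupProduct_eq_zero_of_mem_kummerSelmerStructure_of_fact (p ^ M) e
      (by exact_mod_cast NeZero.ne (p ^ M)) v (kummerClass_cupProduct_kummerClass_eq_zero_holds (Place.Completion v))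
      hμ hadd₁ hadd₂ halt hgal (hloc_s v) (hloc_c' v hv)
    exact (congrArg (inv v) h0).trans (map_zero _)
  -- ### the terms at `v ∈ T`, `v ≠ λ` vanish: `loc_v s = 0`
  have hT : ∀ v ∈ S, v ≠ Sum.inr lam →
      inv v ((weilContPairingLocal (W.baseChange K) (p ^ M) e hμ hadd₁ hadd₂ hgal v).cupProduct
        (galoisCohomology.localization ((W.baseChange K).torsionGaloisModule ((p ^ M : ℕ) : ℤ)) v 1 s)
        (galoisCohomology.localization ((W.baseChange K).torsionGaloisModule ((p ^ M : ℕ) : ℤ)) v 1 c')) = 0 := by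
    intro v hv hne
    rcases Finset.mem_insert.mp hv with h | h
    · exact absurd h hne
    · obtain ⟨v', hv'T, rfl⟩ := Finset.mem_map.mp h
      have h0 : galoisCohomology.localization ((W.baseChange K).torsionGaloisModule ((p ^ M : ℕ) : ℤ))
          (Sum.inr v') 1 s = 0 :=
        localization_eq_zero_of_mem_torsionLocalKer (W.baseChange K) hp0 v' (hsT v' hv'T)
      have hcup0 : (weilContPairingLocal (W.baseChange K) (p ^ M) e hμ hadd₁ hadd₂ hgal
          (Sum.inr v')).cupProduct
        (galoisCohomology.localization ((W.baseChange K).torsionGaloisModule ((p ^ M : ℕ) : ℤ))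
          (Sum.inr v') 1 s)
        (galoisCohomology.localization ((W.baseChange K).torsionGaloisModule ((p ^ M : ℕ) : ℤ))
          (Sum.inr v') 1 c') = 0 := by
        have hz : (weilContPairingLocal (W.baseChange K) (p ^ M) e hμ hadd₁ hadd₂ hgal
            (Sum.inr v')).cupProduct
            (0 : galoisCohomology (((W.baseChange K).torsionGaloisModule ((p ^ M : ℕ) : ℤ)).toLocal
              (Sum.inr v')) 1) = 0 :=
          map_zero _
        rw [h0, hz, LinearMap.zero_apply]
      exact (congrArg (inv (Sum.inr v')) hcup0).trans (map_zero _)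
  -- ### Poitou–Tate: the local term at `λ` vanishes too, hence the local cup product is zero
  have hPTsum := sum_inv_weilCupProduct_localization_eq_zero (W.baseChange K) (p ^ M) e hμ hadd₁ hadd₂ hgal
    inv hsum s c' S hS
  rw [Finset.sum_eq_single_of_mem (Sum.inr lam) hmemS hT] at hPTsum
  have hcup : ((weilContPairing (W.baseChange K) (p ^ M) e hμ hadd₁ hadd₂ hgal).restrict
      (absGaloisRestrict K (lam.adicCompletion K))).cupProduct
        (galoisCohomology.localization ((W.baseChange K).torsionGaloisModule ((p ^ M : ℕ) : ℤ)) (Sum.inr lam) 1 s)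
        (galoisCohomology.localization ((W.baseChange K).torsionGaloisModule ((p ^ M : ℕ) : ℤ)) (Sum.inr lam) 1 c') = 0 :=
    (hperf lam).1.injective (hPTsum.trans (map_zero _).symm)
  -- ### the local step (FILE 1b of the sibling) at `K_λ`: bridge `Γ_K`-decomposition data ↔ `Γ_{K_λ}`
  haveI : Fact p.Prime := ⟨hp⟩
  haveI : CharZero (lam.adicCompletion K) :=
    charZero_of_injective_algebraMap (algebraMap K (lam.adicCompletion K)).injective
  -- good reduction at `λ`, `p ∉ λ`, `p ^ M ∉ λ`
  have hgood : (W.baseChange K).HasGoodReductionAt lam := hgoodL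
  have hpv : ((p : ℕ) : 𝓞 K) ∉ lam.asIdeal :=
    not_natCast_mem_of_prime_ne hℓ.prime hp hℓ.2.2.2.1 lam hℓ.mem_place
  have hqv : ((((p ^ M : ℕ) : ℤ)) : 𝓞 K) ∉ lam.asIdeal := by
    rw [Int.cast_natCast, Nat.cast_pow]
    exact fun h => hpv (lam.isPrime.mem_of_pow_mem M h)
  -- the prime `𝔓₀ ∣ λ` cut out by `K̄ → \bar K_λ`; `g • 𝔔 = 𝔓₀` (transitivity of `Γ_K`)
  have h𝔓₀ : adicCompletionPrime K lam ∈ lam.primesAbove := adicCompletionPrime_mem_primesAbove K lam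
  obtain ⟨g, hg⟩ := HeightOneSpectrum.exists_smul_eq_of_mem_primesAbove_holds h𝔔 h𝔓₀
  have hDeq := decompositionSubgroup_adicCompletionPrime_eq_range K lam
  have hIeq := inertia_adicCompletionPrime_eq_map_absInertia K lam
  -- `F₀ = g F g⁻¹` is a Frobenius at `𝔓₀` fixing `E[p^M]`; `σ₀ = g σ g⁻¹ ∈ I_{𝔓₀}`
  have hF₀ : IsArithFrobAt (𝓞 K) (g * F * g⁻¹) (adicCompletionPrime K lam) := by
    have h := hF.conj g
    rwa [hg] at h
  have hF₀fix : g * F * g⁻¹ ∈ torsionFixing (W.baseChange K) ((p ^ M : ℕ) : ℤ) :=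
    (torsionFixing_normal (W.baseChange K) _).conj_mem F hFfix g
  have hσ₀ : g * σ * g⁻¹ ∈ (adicCompletionPrime K lam).inertia (absoluteGaloisGroup K) := by
    rw [← hg]
    intro x
    have hx := Ideal.smul_mem_pointwise_smul g _ 𝔔 (hσ (g⁻¹ • x))
    rwa [smul_sub, smul_inv_smul, ← mul_smul, ← mul_smul] at hx
  -- inertia at `𝔓₀` fixes `E[p^M]` (good reduction, `λ ∤ p`)
  have hI₀ : (adicCompletionPrime K lam).inertia (absoluteGaloisGroup K) ≤
      torsionFixing (W.baseChange K) ((p ^ M : ℕ) : ℤ) := fun τ hτ =>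
    (mem_torsionFixing_iff _ _).mpr fun Q =>
      (W.baseChange K).smul_geomTorsion_eq_of_mem_inertia hgood hqv h𝔓₀ hτ Q
  have hσ₀fix : g * σ * g⁻¹ ∈ torsionFixing (W.baseChange K) ((p ^ M : ℕ) : ℤ) := hI₀ hσ₀
  -- `F₀ = res gF`, `σ₀ = res t` with `t ∈ I_{K_λ}` (`D_{𝔓₀} = res Γ_{K_λ}`, `I_{𝔓₀} = res I_{K_λ}`)
  obtain ⟨gF, hgF⟩ : ∃ gF : absoluteGaloisGroup (lam.adicCompletion K),
      absGaloisRestrict K (lam.adicCompletion K) gF = g * F * g⁻¹ := by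
    have hmem : g * F * g⁻¹ ∈
        (adicCompletionPrime K lam).decompositionSubgroup (absoluteGaloisGroup K) :=
      hF₀.mem_stabilizer
    rw [hDeq] at hmem
    obtain ⟨gF, hgF⟩ := hmem
    exact ⟨gF, hgF⟩
  obtain ⟨t, ht, hgt⟩ : ∃ t ∈ absInertia (lam.adicCompletion K),
      absGaloisRestrict K (lam.adicCompletion K) t = g * σ * g⁻¹ := by
    have hmem := hσ₀
    rw [hIeq] at hmem
    obtain ⟨t, ht, hgt⟩ := hmem
    exact ⟨t, ht, hgt⟩
  -- `Γ_{K_λ}` acts trivially on `E[p^M]`: `D_{𝔓₀} = ⟨F₀⟩ · I_{𝔓₀} · Γ_{K(E[p^M])}`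
  have htriv : ∀ (g' : absoluteGaloisGroup (lam.adicCompletion K))
      (Q : geomTorsion (W.baseChange K) ((p ^ M : ℕ) : ℤ)),
      absGaloisRestrict K (lam.adicCompletion K) g' • Q = Q := by
    intro g' Q
    have hd : absGaloisRestrict K (lam.adicCompletion K) g' ∈
        (adicCompletionPrime K lam).decompositionSubgroup (absoluteGaloisGroup K) := by
      rw [hDeq]; exact ⟨g', rfl⟩
    obtain ⟨k, i, u, hi, hu, hdeq⟩ := exists_eq_frobenius_pow_mul_of_mem_decompositionSubgroup
      h𝔓₀ hF₀ (isOpen_torsionFixing (W.baseChange K) hp0) hd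
    have hmem : absGaloisRestrict K (lam.adicCompletion K) g' ∈
        torsionFixing (W.baseChange K) ((p ^ M : ℕ) : ℤ) := by
      rw [hdeq]
      exact Subgroup.mul_mem _ (Subgroup.mul_mem _ (Subgroup.pow_mem _ hF₀fix k) (hI₀ hi)) hu
    exact smul_eq_of_mem_torsionFixing _ _ hmem Q
  -- the residue characteristic of `K_λ` is prime to `p ^ M` (`λ ∤ p`)
  have hn : ¬ ringChar 𝓀[lam.adicCompletion K] ∣ p ^ M := fun h =>
    Literature.NumberTheory.GaloisCohomology.PoitouTateFinite.GaloisImage.ringChar_residueField_adicCompletion_ne_of_not_mem lam p hpv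
      ((Nat.prime_dvd_prime_iff_eq (ringChar_residueField_prime (F := lam.adicCompletion K)) hp).mp
        ((ringChar_residueField_prime (F := lam.adicCompletion K)).dvd_of_dvd_pow h)).symm
  -- a frame `E[p^M] ≃ (ℤ/p^M)²`
  obtain ⟨ε₀⟩ := nonempty_addEquiv_geomTorsion (W.baseChange K) p M hM
    (Nat.cast_ne_zero.mpr hp.ne_zero)
  let ε : geomTorsion (W.baseChange K) ((p ^ M : ℕ) : ℤ) ≃+ ZMod (p ^ M) × ZMod (p ^ M) :=
    ε₀.trans (LinearEquiv.finTwoArrow ℤ (ZMod (p ^ M))).toAddEquiv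
  -- the injective local invariant map at `λ`
  have hinv : Function.Injective (inv (Sum.inr lam)) := (hperf lam).1.injective
  -- the local cocycles: restrictions to `Γ_{K_λ}` of the chosen cocycles of `s` and `c'`
  let φ : contOneCocycles (DiscreteGaloisModule.toTopRep (GaloisRep.restrictField
      (lam.adicCompletion K) ((W.baseChange K).torsionGaloisModule ((p ^ M : ℕ) : ℤ)))) :=
    contOneCocycles.pullback (absGaloisRestrict K (lam.adicCompletion K))
      (X := discreteTopRep (absoluteGaloisGroup K) (geomTorsion (W.baseChange K) ((p ^ M : ℕ) : ℤ)))
      (Y := DiscreteGaloisModule.toTopRep (GaloisRep.restrictField (lam.adicCompletion K)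
        ((W.baseChange K).torsionGaloisModule ((p ^ M : ℕ) : ℤ))))
      (TopRep.ofHom ⟨ContinuousLinearMap.id ℤ _, fun _ => rfl⟩)
      (reprCocycle (W.baseChange K) ((p ^ M : ℕ) : ℤ) s)
  let ψ : contOneCocycles (DiscreteGaloisModule.toTopRep (GaloisRep.restrictField
      (lam.adicCompletion K) ((W.baseChange K).torsionGaloisModule ((p ^ M : ℕ) : ℤ)))) :=
    contOneCocycles.pullback (absGaloisRestrict K (lam.adicCompletion K))
      (X := discreteTopRep (absoluteGaloisGroup K) (geomTorsion (W.baseChange K) ((p ^ M : ℕ) : ℤ)))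
      (Y := DiscreteGaloisModule.toTopRep (GaloisRep.restrictField (lam.adicCompletion K)
        ((W.baseChange K).torsionGaloisModule ((p ^ M : ℕ) : ℤ))))
      (TopRep.ofHom ⟨ContinuousLinearMap.id ℤ _, fun _ => rfl⟩)
      (reprCocycle (W.baseChange K) ((p ^ M : ℕ) : ℤ) c')
  have hφcl : galoisCohomology.localization ((W.baseChange K).torsionGaloisModule ((p ^ M : ℕ) : ℤ))
      (Sum.inr lam) 1 s = oneCocycleClass _ φ := by
    have h := (W.baseChange K).res_torsionGaloisModule_oneCocycleClass ((p ^ M : ℕ) : ℤ)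
      (lam.adicCompletion K) (reprCocycle (W.baseChange K) ((p ^ M : ℕ) : ℤ) s)
    rw [oneCocycleClass_reprCocycle] at h
    exact h
  have hψcl : galoisCohomology.localization ((W.baseChange K).torsionGaloisModule ((p ^ M : ℕ) : ℤ))
      (Sum.inr lam) 1 c' = oneCocycleClass _ ψ := by
    have h := (W.baseChange K).res_torsionGaloisModule_oneCocycleClass ((p ^ M : ℕ) : ℤ)
      (lam.adicCompletion K) (reprCocycle (W.baseChange K) ((p ^ M : ℕ) : ℤ) c')
    rw [oneCocycleClass_reprCocycle] at h
    exact h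
  rw [hφcl, hψcl] at hcup
  -- `φ` vanishes on `I_{K_λ}`: `s` is Selmer at the good place `λ ∤ p^M` (Gross (7.1))
  have hsel : s ∈ selmerLocalKer (W.baseChange K) (lam.adicCompletion K) ((p ^ M : ℕ) : ℤ) :=
    ((mem_selmerGroup_iff (W.baseChange K) _ s).mp hs).1 lam
  have hsI : ∀ τ ∈ (adicCompletionPrime K lam).inertia (absoluteGaloisGroup K),
      (reprCocycle (W.baseChange K) ((p ^ M : ℕ) : ℤ) s).1 τ = 0 := by
    have h := hsel
    rw [← oneCocycleClass_reprCocycle (W.baseChange K) ((p ^ M : ℕ) : ℤ) s] at h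
    exact ((W.baseChange K).oneCocycleClass_mem_selmerLocalKer_iff hgood hqv h𝔓₀ _).mp h
  have hφ : ∀ t' ∈ absInertia (lam.adicCompletion K), φ.1 t' = 0 := by
    intro t' ht'
    have hmem : absGaloisRestrict K (lam.adicCompletion K) t' ∈
        (adicCompletionPrime K lam).inertia (absoluteGaloisGroup K) := by
      rw [hIeq]; exact ⟨t', ht', rfl⟩
    have h0 : (reprCocycle (W.baseChange K) ((p ^ M : ℕ) : ℤ) s).1
        (absGaloisRestrict K (lam.adicCompletion K) t') = 0 := hsI _ hmem
    rw [contOneCocycles.pullback_apply, h0, map_zero]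
  -- the sibling's FILE 1b at `K_λ`: `e([s, F₀], [c', σ₀]) = 1`
  have hloc := TameCup.weilPairing_apply_eq_one_of_cupProduct_eq_zero (W.baseChange K) (p ^ M)
    e hμ hadd₁ hadd₂ (lam.adicCompletion K) halt hnondeg hgal ε hn htriv (inv (Sum.inr lam)) hinv
    φ ψ hφ hcup gF t ht
  rw [contOneCocycles.pullback_apply, contOneCocycles.pullback_apply, hgF, hgt] at hloc
  change e (h1Eval (W.baseChange K) ((p ^ M : ℕ) : ℤ) s (g * F * g⁻¹))
    (h1Eval (W.baseChange K) ((p ^ M : ℕ) : ℤ) c' (g * σ * g⁻¹)) = 1 at hloc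
  -- transport along `g`: `[s, F] = g⁻¹ • [s, F₀]`, `[c', σ] = g⁻¹ • [c', σ₀]`, `e` equivariant
  have hconjF : g⁻¹ * (g * F * g⁻¹) * g⁻¹⁻¹ = F := by group
  have hconjσ : g⁻¹ * (g * σ * g⁻¹) * g⁻¹⁻¹ = σ := by group
  have h1 : h1Eval (W.baseChange K) ((p ^ M : ℕ) : ℤ) s F =
      g⁻¹ • h1Eval (W.baseChange K) ((p ^ M : ℕ) : ℤ) s (g * F * g⁻¹) := by
    rw [← h1Eval_conj (W.baseChange K) _ s g⁻¹ hF₀fix, hconjF]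
  have h2 : h1Eval (W.baseChange K) ((p ^ M : ℕ) : ℤ) c' σ =
      g⁻¹ • h1Eval (W.baseChange K) ((p ^ M : ℕ) : ℤ) c' (g * σ * g⁻¹) := by
    rw [← h1Eval_conj (W.baseChange K) _ c' g⁻¹ hσ₀fix, hconjσ]
  rw [TameCup.weilPairingHom_eq_zero_iff, h1, h2, ← hgal, hloc, smul_one]

end Reciprocity

end Literature.NumberTheory.EllipticCurves.McCallum1991.LeafProofs

end Part1

/-!
## Part 2 — port of `Summits/BirchSwinnertonDyer/BirchSwinnertonDyer/Theorems/KolyvaginDepthDoorKolyvaginDepthSupplyZhangGrossPowInvolution.lean` (3 declarations kept)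

# Towards Gross (3.2) modulo `p^M` from W. Zhang's congruences: `Frob_ℓ² = 1` on `E[p^M]` when `p^M ∣ ℓ + 1` and `p^M ∣ a_ℓ`

Declarations of this Part (verbatim port; each keeps its own docstring and citation): `zsmul_eq_zsmul_of_intCast_eq`, `smul_smul_eq_self_of_toZModPow_trace_det`, `frob_smul_smul_eq_self_of_pow_dvd`.

Reference keys (see `references.bib` and the declarations' citations): [SilvermanAEC2009], [GrossLMS1991], [McCallumLMS1991].
-/

section Part2

open scoped _root_.Classical

namespace Literature.NumberTheory.EllipticCurves.McCallum1991.LeafProofs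

open Literature.NumberTheory.EllipticCurves Literature.NumberTheory.GaloisRepresentations
  _root_.WeierstrassCurve _root_.NumberField _root_.IsDedekindDomain _root_.Field

universe u

section Trace

variable {F : Type u} [Field F] (V : WeierstrassCurve F) (ℓ : ℕ) [Fact ℓ.Prime]

/-- Integer multiples of an `N`-torsion point only depend on the residue class modulo `N`.
[cite: SilvermanAEC2009, III.§7] -/
theorem zsmul_eq_zsmul_of_intCast_eq {A : Type*} [AddCommGroup A] {N : ℕ} {P : A}
    (hP : (N : ℤ) • P = 0) {u u' : ℤ} (h : (u : ZMod N) = (u' : ZMod N)) : u • P = u' • P := by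
  obtain ⟨k, hk⟩ := (ZMod.intCast_eq_intCast_iff_dvd_sub u' u N).mp h.symm
  have : u = u' + N * k := by linarith
  rw [this, add_zsmul, mul_comm, mul_zsmul, hP, zsmul_zero, add_zero]

/-- **An element of trace `≡ 0` and determinant `≡ −1 (mod ℓ^{n+1})` on `T_ℓ E` is an involution
of `E[ℓ^{n+1}]`** (`E` over a perfect field, `ℓ ≠ char F`): in the images `P₀, P₁ ∈ E[ℓ^{n+1}]` of a
`ℤ_ℓ`-basis of `T_ℓ E` (which generate `E[ℓ^{n+1}]`, `T_ℓ E → E[ℓ^{n+1}]` being onto) the reduced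
matrix `N` of `σ` has `N² = (tr N)·N − (det N)·1 = 1` — the converse of the tree's
`toZModPow_trace_galoisRepTate_eq_zero`. [cite: SilvermanAEC2009, III.§7] -/
theorem smul_smul_eq_self_of_toZModPow_trace_det [PerfectField F] [V.IsElliptic] (hℓ : (ℓ : F) ≠ 0)
    (n : ℕ) (σ : Field.absoluteGaloisGroup F)
    (htr : PadicInt.toZModPow (n + 1)
        (LinearMap.trace ℤ_[ℓ] (V.tateModule ℓ) (V.galoisRepTate ℓ σ)) = 0)
    (hdet : PadicInt.toZModPow (n + 1)
        (LinearMap.det (V.galoisRepTate ℓ σ : V.tateModule ℓ →ₗ[ℤ_[ℓ]] V.tateModule ℓ)) = -1)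
    {P : V.geomPoints} (hP : P ∈ geomTorsion V ((ℓ ^ (n + 1) : ℕ) : ℤ)) : σ • σ • P = P := by
  have hp : ℓ.Prime := Fact.out
  haveI := module_free_tateModule_holds V ℓ
  haveI := module_finite_tateModule_holds V ℓ
  let b := Module.finBasisOfFinrankEq ℤ_[ℓ] (V.tateModule ℓ) (finrank_tateModule_eq_two_holds V ℓ hℓ)
  set N : ℕ := ℓ ^ (n + 1) with hN
  haveI : NeZero N := ⟨pow_ne_zero _ hp.ne_zero⟩
  set red : ℤ_[ℓ] →+* ZMod N := PadicInt.toZModPow (n + 1) with hred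
  set M := LinearMap.toMatrix b b (V.galoisRepTate ℓ σ) with hMdef
  set P₀ := TateModule.proj ℓ (n + 1) (b 0) with hP₀
  set P₁ := TateModule.proj ℓ (n + 1) (b 1) with hP₁
  have hP₀N : (N : ℤ) • P₀ = 0 := by
    rw [natCast_zsmul, hP₀, hN]; exact TateModule.pow_smul_proj (n + 1) (b 0)
  have hP₁N : (N : ℤ) • P₁ = 0 := by
    rw [natCast_zsmul, hP₁, hN]; exact TateModule.pow_smul_proj (n + 1) (b 1)
  -- ### the columns of `σ` on `P₀, P₁`
  have hcol : ∀ j, σ • TateModule.proj ℓ (n + 1) (b j) =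
      ((red (M 0 j)).val : ℤ) • P₀ + ((red (M 1 j)).val : ℤ) • P₁ := fun j ↦ by
    have h1 : σ • TateModule.proj ℓ (n + 1) (b j) =
        TateModule.proj ℓ (n + 1) (V.galoisRepTate ℓ σ (b j)) := by
      rw [galoisRepTate_apply_apply, TateModule.proj_smul_of_distribMulAction]
    rw [h1, proj_eq_sum_repr V ℓ b _ (n + 1), hMdef, LinearMap.toMatrix_apply,
      LinearMap.toMatrix_apply, natCast_zsmul, natCast_zsmul]
  set a := red (M 0 0) with ha
  set bb := red (M 0 1) with hbb
  set c := red (M 1 0) with hc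
  set d := red (M 1 1) with hd
  have hσ0 : σ • P₀ = (a.val : ℤ) • P₀ + (c.val : ℤ) • P₁ := hcol 0
  have hσ1 : σ • P₁ = (bb.val : ℤ) • P₀ + (d.val : ℤ) • P₁ := hcol 1
  have hzs : ∀ (g : Field.absoluteGaloisGroup F) (k : ℤ) (X : V.geomPoints),
      g • (k • X) = k • (g • X) := fun g k X ↦ smul_comm g k X
  -- ### trace and determinant in coordinates
  have htr' : a + d = 0 := by
    rw [LinearMap.trace_eq_matrix_trace ℤ_[ℓ] b, ← hMdef, Matrix.trace_fin_two, map_add] at htr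
    exact htr
  have hdet' : a * d - bb * c = -1 := by
    rw [← hdet, ← LinearMap.det_toMatrix b, ← hMdef, RingHom.map_det, Matrix.det_fin_two]
    simp only [RingHom.mapMatrix_apply, Matrix.map_apply]
    rw [ha, hbb, hc, hd]
  -- ### `σ² = 1` on `P₀` and `P₁`
  have hsq0 : σ • σ • P₀ = P₀ := by
    rw [hσ0, smul_add, hzs, hzs, hσ0, hσ1]
    have hcalc : (a.val : ℤ) • ((a.val : ℤ) • P₀ + (c.val : ℤ) • P₁) +
        (c.val : ℤ) • ((bb.val : ℤ) • P₀ + (d.val : ℤ) • P₁) =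
        ((a.val : ℤ) * a.val + (c.val : ℤ) * bb.val) • P₀ +
          ((a.val : ℤ) * c.val + (c.val : ℤ) * d.val) • P₁ := by
      simp only [add_zsmul, mul_zsmul, zsmul_add]; abel
    rw [hcalc, zsmul_eq_zsmul_of_intCast_eq hP₀N (u' := 1) (by
        push_cast; simp only [ZMod.natCast_zmod_val]; linear_combination a * htr' - hdet'),
      zsmul_eq_zsmul_of_intCast_eq hP₁N (u' := 0) (by
        push_cast; simp only [ZMod.natCast_zmod_val]; linear_combination c * htr'),
      one_zsmul, zero_zsmul, add_zero]
  have hsq1 : σ • σ • P₁ = P₁ := by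
    rw [hσ1, smul_add, hzs, hzs, hσ0, hσ1]
    have hcalc : (bb.val : ℤ) • ((a.val : ℤ) • P₀ + (c.val : ℤ) • P₁) +
        (d.val : ℤ) • ((bb.val : ℤ) • P₀ + (d.val : ℤ) • P₁) =
        ((bb.val : ℤ) * a.val + (d.val : ℤ) * bb.val) • P₀ +
          ((bb.val : ℤ) * c.val + (d.val : ℤ) * d.val) • P₁ := by
      simp only [add_zsmul, mul_zsmul, zsmul_add]; abel
    rw [hcalc, zsmul_eq_zsmul_of_intCast_eq hP₀N (u' := 0) (by
        push_cast; simp only [ZMod.natCast_zmod_val]; linear_combination bb * htr'),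
      zsmul_eq_zsmul_of_intCast_eq hP₁N (u' := 1) (by
        push_cast; simp only [ZMod.natCast_zmod_val]; linear_combination d * htr' - hdet'),
      one_zsmul, zero_zsmul, zero_add]
  -- ### every `P ∈ E[ℓ^{n+1}]` is a combination of `P₀, P₁`
  obtain ⟨t, ht⟩ := proj_surjective_of_isAlgClosed_holds V ℓ (n + 1) hP
  rw [← ht, proj_eq_sum_repr V ℓ b t (n + 1), ← hP₀, ← hP₁, smul_add, smul_add, ← natCast_zsmul,
    ← natCast_zsmul, hzs, hzs, hzs, hzs, hsq0, hsq1]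

end Trace

section Rational

variable (W : WeierstrassCurve ℚ) [W.IsElliptic]

/-- **`Frob_ℓ² = 1` on `E[p^{n+1}](ℚ̄)` at a Zhang–Kolyvagin prime of index `≥ n + 1`.** For
`E = W/ℚ` elliptic with good reduction at the place `v` above the prime `ℓ ≠ p`, `𝔓 ∣ v` a prime of
`\bar ℤ`, `h` an arithmetic Frobenius at `𝔓`, and `p^{n+1} ∣ ℓ + 1`, `p^{n+1} ∣ a_ℓ`
(`a_ℓ = W.frobeniusTraceAt v`): `h (h P) = P` for every `P ∈ E[p^{n+1}]`. Proof: `tr(h | T_p E) = a_ℓ`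
and `det(h | T_p E) = N v = ℓ` (Silverman C.21 Remark 21.3; the tree's
`trace/det_galoisRepTate_frobenius_of_hasGoodReductionAt_holds`), so modulo `p^{n+1}` the trace is
`0` and the determinant `−1`; then `smul_smul_eq_self_of_toZModPow_trace_det`.
[cite: GrossLMS1991, §3 (3.2)–(3.3)] [cite: McCallumLMS1991, §4] [cite: SilvermanAEC2009, C.21 Remark 21.3] -/
theorem frob_smul_smul_eq_self_of_pow_dvd {p : ℕ} [Fact p.Prime] (n : ℕ) {ℓ : ℕ} (hℓ : ℓ.Prime)
    (hℓp : ℓ ≠ p) {v : HeightOneSpectrum (𝓞 ℚ)} (hℓv : (ℓ : 𝓞 ℚ) ∈ v.asIdeal)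
    (hgood : W.HasGoodReductionAt v) {𝔓 : Ideal (absIntegers (𝓞 ℚ) ℚ)} (h𝔓 : 𝔓 ∈ v.primesAbove)
    {h : absoluteGaloisGroup ℚ} (hh : IsArithFrobAt (𝓞 ℚ) h 𝔓)
    (hℓ1 : p ^ (n + 1) ∣ ℓ + 1) (ha : ((p : ℤ) ^ (n + 1)) ∣ W.frobeniusTraceAt v)
    {P : W.geomPoints} (hP : P ∈ geomTorsion W ((p ^ (n + 1) : ℕ) : ℤ)) : h • h • P = P := by
  have hp : p.Prime := Fact.out
  have hpQ : (p : ℚ) ≠ 0 := by exact_mod_cast hp.ne_zero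
  have hpv : (p : 𝓞 ℚ) ∉ v.asIdeal := not_natCast_mem_of_prime_ne hℓ hp hℓp v hℓv
  -- `tr = a_ℓ ≡ 0`
  have htr := W.trace_galoisRepTate_frobenius_of_hasGoodReductionAt_holds p v hpv hgood h𝔓 hh
  have htr0 : PadicInt.toZModPow (n + 1)
      (LinearMap.trace ℤ_[p] (W.tateModule p) (W.galoisRepTate p h)) = 0 := by
    rw [htr, map_intCast, ZMod.intCast_zmod_eq_zero_iff_dvd]
    exact_mod_cast ha
  -- `det = N v = ℓ ≡ -1`
  have hdet := W.det_galoisRepTate_frobenius_of_hasGoodReductionAt_holds p v hpv hgood h𝔓 hh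
  have hcard : Nat.card (IsLocalRing.ResidueField (v.adicCompletionIntegers ℚ)) = ℓ := by
    rw [natCard_residueField_adicCompletionIntegers, primesEquiv_eq_of_natCast_mem hℓ hℓv]
  have hdet1 : PadicInt.toZModPow (n + 1)
      (LinearMap.det (W.galoisRepTate p h : W.tateModule p →ₗ[ℤ_[p]] W.tateModule p)) = -1 := by
    rw [hdet, hcard, map_natCast]
    have h3 : ((ℓ + 1 : ℕ) : ZMod (p ^ (n + 1))) = 0 := by
      rw [ZMod.natCast_eq_zero_iff]; exact hℓ1
    rw [Nat.cast_add, Nat.cast_one] at h3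
    exact eq_neg_of_add_eq_zero_left h3
  exact smul_smul_eq_self_of_toZModPow_trace_det W p hpQ n h htr0 hdet1 hP

end Rational

end Literature.NumberTheory.EllipticCurves.McCallum1991.LeafProofs

end Part2

/-!
## Part 3 — port of `Summits/BirchSwinnertonDyer/BirchSwinnertonDyer/Theorems/KolyvaginDepthDoorKolyvaginDepthSupplyZhangGrossPow.lean` (2 declarations kept)

# W. Zhang's Kolyvagin primes of index `≥ M` are Gross's of level `M`: `Frob(ℓ) = Frob(∞)` in `Gal(K(E[p^M])/ℚ)` from `p^M ∣ ℓ + 1`, `p^M ∣ a_ℓ`, under `ρ_{E,p^M}` onto (odd `p`)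

Declarations of this Part (verbatim port; each keeps its own docstring and citation): `frobEqFrobInfty_pow_of_zhang`, `isKolyvaginPrime_and_frobEqFrobInfty_pow_of_zhang`.

Reference keys (see `references.bib` and the declarations' citations): [WZhang2014], [McCallumLMS1991], [GrossLMS1991].
-/

section Part3

open scoped _root_.Classical _root_.Pointwise

namespace Literature.NumberTheory.EllipticCurves.McCallum1991.LeafProofs

open _root_.WeierstrassCurve _root_.Field _root_.Function _root_.NumberField _root_.IsDedekindDomain _root_.Rat.HeightOneSpectrum
open Literature.NumberTheory.EllipticCurves Literature.NumberTheory.GaloisRepresentations _root_.Module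
open Literature.NumberTheory.EllipticCurves.McCallum1991.AuxPrimes
open Literature.NumberTheory.EllipticCurves.McCallum1991.ZhangGross

section Gross

variable (W : WeierstrassCurve ℚ) [W.IsElliptic] [W.IsGloballyMinimal] (K : Type) [Field K]
  [NumberField K]

/-- **W. Zhang's Kolyvagin primes of index `≥ M` satisfy Gross's (3.2) modulo `p^M`** when
`ρ_{E,p^M}` is onto (`p` odd, `K` imaginary quadratic, `M ≥ 1`): `FrobEqFrobInfty W K (p^M) ℓ`.
Proof: module docstring. [cite: McCallumLMS1991, §4 (p. 299), §5 Lemma 5.3]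
[cite: GrossLMS1991, §3 (3.2)–(3.3)] [cite: WZhang2014, Notations (xii)] -/
theorem frobEqFrobInfty_pow_of_zhang (hK : IsImaginaryQuadratic K) {p : ℕ} [Fact p.Prime]
    (hp2 : p ≠ 2) {M : ℕ} (hM : 1 ≤ M)
    (hsurjM : W.HasSurjectiveModNGaloisRep (p ^ M : ℕ)) {ℓ : ℕ}
    (hℓ : Zhang2014.IsKolyvaginPrime (W.conductorNorm ℤ) W K p ℓ)
    (hℓM : M ≤ Zhang2014.kolyvaginIndex W p ℓ) : FrobEqFrobInfty W K (p ^ M) ℓ := by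
  have hp : p.Prime := Fact.out
  obtain ⟨n, rfl⟩ : ∃ n, M = n + 1 := ⟨M - 1, by omega⟩
  haveI : Fact (2 < p) := ⟨lt_of_le_of_ne hp.two_le (Ne.symm hp2)⟩
  have hne1 : (-1 : ZMod p) ≠ 1 := ZMod.neg_one_ne_one
  haveI : Algebra.IsQuadraticExtension ℚ K := ⟨hK.1⟩
  haveI : IsTotallyComplex K := hK.2
  have hℓp : ℓ.Prime := hℓ.1
  haveI : Fact ℓ.Prime := ⟨hℓp⟩
  have hℓ3 : ℓ ≠ p := hℓ.2.2.2.1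
  have hℓP : (Ideal.span {(ℓ : 𝓞 K)}).IsPrime := hℓ.2.2.2.2.1
  have hdvd := Zhang2014.IsKolyvaginPrime.dvd (p := p) hℓ
  have hdvdM := (Zhang2014.le_kolyvaginIndex_iff (W := W) (p := p)).mp hℓM
  set N : ℕ := p ^ (n + 1) with hN
  haveI : NeZero N := ⟨pow_ne_zero _ hp.ne_zero⟩
  -- ### places: `w = (ℓ)` in `K`, `v₁` below it in `ℚ`, a prime `𝔓 ∣ w` of `\bar ℤ_K`, `𝔓' = 𝔓 ∩ \bar ℤ`
  let w : HeightOneSpectrum (𝓞 K) := ⟨Ideal.span {(ℓ : 𝓞 K)}, hℓP, by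
    rw [Ne, Ideal.span_singleton_eq_bot]; exact_mod_cast hℓp.ne_zero⟩
  have hw : (ℓ : 𝓞 K) ∈ w.asIdeal := Ideal.mem_span_singleton_self _
  set v₁ : HeightOneSpectrum (𝓞 ℚ) := w.under (𝓞 ℚ) with hv₁
  have hwv₁ : w.asIdeal.under (𝓞 ℚ) = v₁.asIdeal := rfl
  have hℓv₁ : (ℓ : 𝓞 ℚ) ∈ v₁.asIdeal := by
    rw [← hwv₁, Ideal.under_def, Ideal.mem_comap, map_natCast]; exact hw
  have hv₁ℓ : (primesEquiv v₁ : ℕ) = ℓ := primesEquiv_eq_of_natCast_mem hℓp hℓv₁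
  obtain ⟨𝔐, h𝔐⟩ := w.localPrimesAbove_nonempty
  set 𝔓 := w.primeBelow (closureEmb (K := K) (w.adicCompletion K)) 𝔐 with h𝔓def
  have h𝔓 : 𝔓 ∈ w.primesAbove := HeightOneSpectrum.primeBelow_mem_primesAbove h𝔐
  set 𝔓' := 𝔓.comap (absIntegersMap ℚ K) with h𝔓'def
  have h𝔓' : 𝔓' ∈ v₁.primesAbove := comap_absIntegersMap_mem_primesAbove hwv₁ h𝔓
  have hgoodv : W.HasGoodReductionAt v₁ :=
    LocalFrob.hasGoodReductionAt_rat_of_not_dvd_conductorNorm W hℓp hℓ.2.1 v₁ hℓv₁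
  have hgood : W.HasGoodReductionAtPrime ℓ :=
    (hasGoodReductionAtPrime_primesEquiv_iff_holds W v₁ ℓ hv₁ℓ).mpr hgoodv
  -- ### the two involutions: a Frobenius `h₀` above `ℓ` and a complex conjugation `c₀`
  obtain ⟨h₀, hh₀⟩ := HeightOneSpectrum.exists_isArithFrobAt_of_mem_primesAbove_holds h𝔓'
  obtain ⟨c₀, hc₀⟩ := exists_isComplexConjugation (Rat.castHom ℝ)
  -- level `p`: `h₀² = 1` on `E[p]`, eigenvectors of both signs for `h₀` and `c₀`
  have hA2 : ∀ P : geomTorsion W ((p : ℕ) : ℤ), h₀ • h₀ • P = P := fun P ↦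
    frob_sq_smul_eq_self_of_dvd W hℓ3 hgood hdvd.1 hdvd.2 hv₁ℓ h𝔓' hh₀ P
  have hWp : W.exists_weilPairing p := exists_weilPairing_holds W p
  obtain ⟨⟨b₁, hb₁0, hb₁⟩, ⟨b₂, hb₂0, hb₂⟩⟩ := RatClosure.exists_eigenvectors W hc₀ hWp hp2
  letI : Module (ZMod p) (geomTorsion W ((p : ℕ) : ℤ)) := AddSubgroup.torsionBy.zmodModule
  have h2 : Module.finrank (ZMod p) (geomTorsion W ((p : ℕ) : ℤ)) = 2 :=
    Literature.RepresentationTheory.FiniteGroups.Representation.finrank_eq_two_of_natCard_eq_sq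
      (card_torsionPoints_eq_sq_holds W (AlgebraicClosure ℚ) (n := p)
        (by exact_mod_cast hp.ne_zero))
  haveI : FiniteDimensional (ZMod p) (geomTorsion W ((p : ℕ) : ℤ)) :=
    Module.finite_of_finrank_eq_succ h2
  set f := (galoisRepTorsion W ((p : ℕ) : ℤ) h₀).toAdd.toAddMonoidHom.toZModLinearMap p with hfdef
  have hf : ∀ Q, f Q = h₀ • Q := fun Q => rfl
  have hdet : LinearMap.det f = (ℓ : ZMod p) :=
    W.det_galoisRepTorsion_frobenius_eq p hℓ3 hgood hv₁ℓ h𝔓' hh₀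
  have hℓm : (ℓ : ZMod p) = -1 := by
    have h3 : ((ℓ + 1 : ℕ) : ZMod p) = 0 := by rw [ZMod.natCast_eq_zero_iff]; exact hdvd.1
    rw [Nat.cast_add, Nat.cast_one] at h3
    exact eq_neg_of_add_eq_zero_left h3
  have hnot_id : ¬ ∀ P : geomTorsion W ((p : ℕ) : ℤ), h₀ • P = P := by
    intro hall
    have hfid : f = LinearMap.id := LinearMap.ext fun P ↦ by rw [hf, hall]; rfl
    have : LinearMap.det f = 1 := by rw [hfid, LinearMap.det_id]
    rw [hdet, hℓm] at this
    exact hne1 this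
  have hnot_neg : ¬ ∀ P : geomTorsion W ((p : ℕ) : ℤ), h₀ • P = -P := by
    intro hall
    have hfid : f = (-1 : ZMod p) • LinearMap.id := LinearMap.ext fun P ↦ by
      rw [hf, hall, LinearMap.smul_apply, LinearMap.id_apply, neg_one_smul]
    have : LinearMap.det f = 1 := by
      rw [hfid, LinearMap.det_smul, LinearMap.det_id, h2]; norm_num
    rw [hdet, hℓm] at this
    exact hne1 this
  obtain ⟨u, hu⟩ := not_forall.mp hnot_neg
  obtain ⟨u', hu'⟩ := not_forall.mp hnot_id
  have ha₁ : h₀ • (h₀ • u + u) = h₀ • u + u := by rw [smul_add, hA2, add_comm]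
  have ha₁0 : h₀ • u + u ≠ 0 := fun h0 ↦ hu (eq_neg_of_add_eq_zero_left h0)
  have ha₂ : h₀ • (h₀ • u' - u') = -(h₀ • u' - u') := by rw [smul_sub, hA2, neg_sub]
  have ha₂0 : h₀ • u' - u' ≠ 0 := fun h0 ↦ hu' (sub_eq_zero.mp h0)
  -- ### level `p^{n+1}`: `T = E[p^{n+1}]`, both involutions, eigen-generators, the conjugator
  set T := geomTorsion W ((N : ℕ) : ℤ) with hTdef
  -- `h₀² = 1` on `T` (PART 1) and `c₀² = 1`
  have haℓ : ((p : ℤ) ^ (n + 1)) ∣ W.frobeniusTraceAt v₁ := by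
    rw [frobeniusTraceAt_eq_frobeniusTrace W v₁, show ((primesEquiv v₁ : ℕ)) = ℓ from hv₁ℓ]
    exact_mod_cast hdvdM.2
  have hA2N : ∀ P : T, h₀ • h₀ • P = P := fun P ↦ by
    apply Subtype.ext
    exact frob_smul_smul_eq_self_of_pow_dvd W n hℓp hℓ3 hℓv₁ hgoodv h𝔓' hh₀ hdvdM.1 haℓ P.2
  have hC2N : ∀ P : T, c₀ • c₀ • P = P := fun P ↦ by
    rw [← mul_smul, ← pow_two, hc₀.sq_eq_one, one_smul]
  let ι₁ : T →+ T := DistribSMul.toAddMonoidHom T h₀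
  let ι₂ : T →+ T := DistribSMul.toAddMonoidHom T c₀
  have hι₁ : ∀ x, ι₁ x = h₀ • x := fun x ↦ rfl
  have hι₂ : ∀ x, ι₂ x = c₀ • x := fun x ↦ rfl
  -- `T` is killed by `p^{n+1}`, has order `p^{2(n+1)}`, and `T[p] = E[p]` has order `p²`
  have hTN : ∀ t : T, p ^ (n + 1) • t = 0 := fun t ↦ by
    have := (mem_geomTorsion_iff W ((N : ℕ) : ℤ) _).mp t.2
    apply Subtype.ext
    rw [AddSubgroupClass.coe_nsmul, ← natCast_zsmul]
    exact this
  have hcardT : Nat.card T = p ^ (2 * (n + 1)) := by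
    have h : Nat.card T = N ^ 2 :=
      card_torsionPoints_eq_sq_holds W (AlgebraicClosure ℚ) (n := N) (by exact_mod_cast NeZero.ne N)
    rw [h, hN, ← pow_mul, mul_comm]
  haveI : Finite T := Nat.finite_of_card_ne_zero (by rw [hcardT]; exact pow_ne_zero _ hp.ne_zero)
  -- the inclusion `E[p] ⊆ E[p^{n+1}]`
  have hmemN : ∀ P : geomTorsion W ((p : ℕ) : ℤ), (P : W.geomPoints) ∈ T := fun P ↦ by
    have hP := (mem_geomTorsion_iff W ((p : ℕ) : ℤ) (P : W.geomPoints)).mp P.2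
    rw [hTdef, mem_geomTorsion_iff, hN, Nat.cast_pow, pow_succ, mul_smul, hP, smul_zero]
  let incl : geomTorsion W ((p : ℕ) : ℤ) → T := fun P ↦ ⟨P, hmemN P⟩
  have hincl0 : ∀ {P : geomTorsion W ((p : ℕ) : ℤ)}, P ≠ 0 → incl P ≠ 0 := fun {P} hP h0 ↦ by
    have h1 : ((incl P : T) : W.geomPoints) = ((0 : T) : W.geomPoints) := congrArg Subtype.val h0
    exact hP (Subtype.ext h1)
  have hinclp : ∀ P : geomTorsion W ((p : ℕ) : ℤ), p • incl P = 0 := fun P ↦ by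
    apply Subtype.ext
    rw [AddSubgroupClass.coe_nsmul, ← natCast_zsmul]
    exact (mem_geomTorsion_iff W ((p : ℕ) : ℤ) _).mp P.2
  have hincl_smul : ∀ (g : absoluteGaloisGroup ℚ) (P : geomTorsion W ((p : ℕ) : ℤ)),
      g • incl P = incl (g • P) := fun g P ↦ Subtype.ext rfl
  have hcardp : Nat.card {x : T // p • x = 0} = p ^ 2 := by
    have e : {x : T // p • x = 0} ≃ geomTorsion W ((p : ℕ) : ℤ) :=
      { toFun := fun x ↦ ⟨(x.1 : W.geomPoints), by
          have h := congrArg Subtype.val x.2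
          simp only [AddSubgroupClass.coe_nsmul, ZeroMemClass.coe_zero] at h
          rw [mem_geomTorsion_iff, natCast_zsmul]
          exact h⟩
        invFun := fun P ↦ ⟨incl P, hinclp P⟩
        left_inv := fun x ↦ Subtype.ext (Subtype.ext rfl)
        right_inv := fun P ↦ Subtype.ext rfl }
    rw [Nat.card_congr e]
    exact card_torsionPoints_eq_sq_holds W (AlgebraicClosure ℚ) (n := p)
      (by exact_mod_cast hp.ne_zero)
  -- eigen-generators for `h₀` and for `c₀` (McCallum's Lemma 5.3 count)
  obtain ⟨u₁, w₁, hu₁, hw₁, -, -, hspan₁, hou₁, how₁⟩ :=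
    KolyvaginEigenPow.exists_eigen_generators hp hp2 hTN hcardT hcardp ι₁
      (fun x ↦ by rw [hι₁, hι₁, hA2N])
      (hincl0 ha₁0) (hinclp _) (by rw [hι₁, hincl_smul, ha₁])
      (hincl0 ha₂0) (hinclp _) (by
        rw [hι₁, hincl_smul, ha₂]; exact Subtype.ext rfl)
  obtain ⟨u₂, w₂, hu₂, hw₂, -, -, hspan₂, hou₂, how₂⟩ :=
    KolyvaginEigenPow.exists_eigen_generators hp hp2 hTN hcardT hcardp ι₂
      (fun x ↦ by rw [hι₂, hι₂, hC2N])
      (hincl0 hb₁0) (hinclp _) (by rw [hι₂, hincl_smul, hb₁])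
      (hincl0 hb₂0) (hinclp _) (by
        rw [hι₂, hincl_smul, hb₂]; exact Subtype.ext rfl)
  -- `ℤ/p^{n+1}`-bases `(u₁, w₁)`, `(u₂, w₂)` of `T`
  letI : Module (ZMod N) T := AddSubgroup.torsionBy.zmodModule
  have hsmulval : ∀ (s : ZMod N) (x : T), s • x = s.val • x := fun s x ↦ by
    conv_lhs => rw [← ZMod.natCast_zmod_val s]
    exact Nat.cast_smul_eq_nsmul (ZMod N) s.val x
  have hbasis : ∀ (ι : T →+ T) (u w : T), ι u = u → ι w = -w →
      (∀ z, ∃ β δ : ℤ, z = β • u + δ • w) → addOrderOf u = p ^ (n + 1) →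
      addOrderOf w = p ^ (n + 1) →
      LinearIndependent (ZMod N) ![u, w] ∧ ⊤ ≤ Submodule.span (ZMod N) (Set.range ![u, w]) := by
    intro ι u w hu hw hspan hou how
    refine ⟨LinearIndependent.pair_iff.mpr fun s t hst ↦ ?_, fun z _ ↦ ?_⟩
    · -- `s • u = -(t • w)` lies in both eigen-parts, hence is `0`
      rw [hsmulval, hsmulval] at hst
      have hy : ι (s.val • u) = s.val • u := by rw [map_nsmul, hu]
      have hy' : ι (s.val • u) = -(s.val • u) := by
        rw [eq_neg_of_add_eq_zero_left hst, map_neg, map_nsmul, hw, smul_neg, neg_neg]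
      have h2y : 2 • (s.val • u) = 0 := by
        rw [two_nsmul]
        nth_rw 2 [← hy]
        rw [hy', add_neg_cancel]
      have hsu : s.val • u = 0 := KolyvaginEigenPow.eq_zero_of_two_nsmul_eq_zero hp hp2 hTN h2y
      have htw : t.val • w = 0 := by rwa [hsu, zero_add] at hst
      have hs : s = 0 := by
        have hd : p ^ (n + 1) ∣ s.val := hou ▸ addOrderOf_dvd_of_nsmul_eq_zero hsu
        have hlt : s.val < p ^ (n + 1) := hN ▸ ZMod.val_lt s
        have : s.val = 0 := Nat.eq_zero_of_dvd_of_lt hd hlt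
        exact (ZMod.val_eq_zero s).mp this
      have ht : t = 0 := by
        have hd : p ^ (n + 1) ∣ t.val := how ▸ addOrderOf_dvd_of_nsmul_eq_zero htw
        have hlt : t.val < p ^ (n + 1) := hN ▸ ZMod.val_lt t
        have : t.val = 0 := Nat.eq_zero_of_dvd_of_lt hd hlt
        exact (ZMod.val_eq_zero t).mp this
      exact ⟨hs, ht⟩
    · obtain ⟨β, δ, hz⟩ := hspan z
      rw [hz, ← Int.cast_smul_eq_zsmul (ZMod N) β u, ← Int.cast_smul_eq_zsmul (ZMod N) δ w]
      exact Submodule.add_mem _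
        (Submodule.smul_mem _ _ (Submodule.subset_span ⟨0, rfl⟩))
        (Submodule.smul_mem _ _ (Submodule.subset_span ⟨1, rfl⟩))
  obtain ⟨hli₁, hsp₁⟩ := hbasis ι₁ u₁ w₁ hu₁ hw₁ hspan₁ hou₁ how₁
  obtain ⟨hli₂, hsp₂⟩ := hbasis ι₂ u₂ w₂ hu₂ hw₂ hspan₂ hou₂ how₂
  let bA := Module.Basis.mk hli₁ hsp₁
  let bB := Module.Basis.mk hli₂ hsp₂
  have hbA0 : bA 0 = u₁ := by rw [Module.Basis.coe_mk]; rfl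
  have hbA1 : bA 1 = w₁ := by rw [Module.Basis.coe_mk]; rfl
  have hbB0 : bB 0 = u₂ := by rw [Module.Basis.coe_mk]; rfl
  have hbB1 : bB 1 = w₂ := by rw [Module.Basis.coe_mk]; rfl
  let Φ : T ≃ₗ[ZMod N] T := bA.equiv bB (Equiv.refl _)
  have hΦ0 : Φ u₁ = u₂ := by rw [← hbA0, Module.Basis.equiv_apply, Equiv.refl_apply, hbB0]
  have hΦ1 : Φ w₁ = w₂ := by rw [← hbA1, Module.Basis.equiv_apply, Equiv.refl_apply, hbB1]
  -- `Φ ∘ h₀ = c₀ ∘ Φ`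
  set f₁ := ι₁.toZModLinearMap N with hf₁def
  set f₂ := ι₂.toZModLinearMap N with hf₂def
  have hf₁ : ∀ Q, f₁ Q = h₀ • Q := fun Q => rfl
  have hf₂ : ∀ Q, f₂ Q = c₀ • Q := fun Q => rfl
  have hΦA : ∀ P, Φ (h₀ • P) = c₀ • Φ P := by
    have hlin : Φ.toLinearMap ∘ₗ f₁ = f₂ ∘ₗ Φ.toLinearMap := by
      refine bA.ext fun i ↦ ?_
      fin_cases i
      · change Φ (f₁ (bA 0)) = f₂ (Φ (bA 0))
        rw [hf₁, hf₂, hbA0, ← hι₁, hu₁, hΦ0, ← hι₂, hu₂]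
      · change Φ (f₁ (bA 1)) = f₂ (Φ (bA 1))
        rw [hf₁, hf₂, hbA1, ← hι₁, hw₁, map_neg, hΦ1, ← hι₂, hw₂]
    intro P
    have := congrArg (fun f ↦ f P) hlin
    simpa only [LinearMap.comp_apply, LinearEquiv.coe_coe, hf₁, hf₂] using this
  -- the conjugator `g` with `ρ_{E,p^{n+1}}(g) = Φ`
  obtain ⟨g, hg⟩ := hsurjM (Multiplicative.ofAdd Φ.toAddEquiv)
  have hgP : ∀ P : T, g • P = Φ P := fun P ↦ by
    have := congrArg (fun φ ↦ (Multiplicative.toAdd φ) P) hg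
    simpa using this
  set h := g * h₀ * g⁻¹ with hhdef
  have hhP : ∀ P : T, h • P = c₀ • P := fun P ↦ by
    have hg' : g⁻¹ • P = Φ.symm P := by
      rw [inv_smul_eq_iff, hgP, LinearEquiv.apply_symm_apply]
    rw [hhdef, mul_smul, mul_smul, hg', hgP, hΦA, LinearEquiv.apply_symm_apply]
  have hhFrob : IsArithFrobAt (𝓞 ℚ) h (g • 𝔓') := hh₀.conj g
  -- ### on `K`: `h` and `c₀` both restrict to the non-trivial automorphism
  letI : Algebra K (AlgebraicClosure ℚ) := (absEmbedding ℚ K).toRingHom.toAlgebra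
  haveI : IsScalarTower ℚ K (AlgebraicClosure ℚ) :=
    IsScalarTower.of_algebraMap_eq fun q ↦ ((absEmbedding ℚ K).commutes q).symm
  let r : absoluteGaloisGroup ℚ →* (K ≃ₐ[ℚ] K) :=
    (AlgEquiv.restrictNormalHom K).comp (absoluteGaloisGroup.toAlgEquiv ℚ).toMonoidHom
  have hr : ∀ (σ : absoluteGaloisGroup ℚ) (x : K), σ • absEmbedding ℚ K x = absEmbedding ℚ K (r σ x) :=
    fun σ x ↦ by
    have := AlgEquiv.restrictNormal_commutes (absoluteGaloisGroup.toAlgEquiv ℚ σ) K x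
    rw [absoluteGaloisGroup.smul_def]
    exact this.symm
  have hrange : ∀ σ : absoluteGaloisGroup ℚ, r σ = 1 → σ ∈ (absGaloisRestrict ℚ K).range := by
    intro σ hσ
    rw [mem_range_absGaloisRestrict_iff_smul_absEmbedding]
    intro x
    rw [hr, hσ, AlgEquiv.one_apply]
  have hf2 := LocalFrob.inertiaDeg_eq_two_of_isPrime_span K hK.1 hℓp hℓP w hw
  have hrh₀ : r h₀ ≠ 1 := by
    intro h1
    obtain ⟨τ, hτ⟩ := MonoidHom.mem_range.mp (hrange h₀ h1)
    have hτ' : absGaloisRestrict ℚ K τ = h₀ := hτ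
    have hf1 := inertiaDeg_eq_one_of_isArithFrobAt_absGaloisRestrict (F := ℚ) (M := K) hwv₁ h𝔓 (τ := τ)
      (by rw [hτ']; exact hh₀)
    rw [hf2] at hf1
    exact absurd hf1 (by norm_num)
  have hrc₀ : r c₀ ≠ 1 := fun h1 ↦
    Rat.not_mem_range_absGaloisRestrict_of_isComplexConjugation K hK.2 hc₀ (hrange c₀ h1)
  have hcard : Nat.card (K ≃ₐ[ℚ] K) = 2 := by rw [IsGalois.card_aut_eq_finrank, hK.1]
  obtain ⟨y, -, hy⟩ := (Nat.card_eq_two_iff' (1 : K ≃ₐ[ℚ] K)).mp hcard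
  have hrh : r h = y := by
    have hrh0 : r h₀ = y := hy _ hrh₀
    rw [hhdef, map_mul, map_mul, map_inv, hrh0]
    by_cases hrg : r g = 1
    · rw [hrg, one_mul, inv_one, mul_one]
    · rw [hy _ hrg, mul_inv_cancel_right]
  have hmem : c₀⁻¹ * h ∈ (absGaloisRestrict ℚ K).range := by
    refine hrange _ ?_
    rw [map_mul, map_inv, hrh, hy _ hrc₀, inv_mul_cancel]
  obtain ⟨τ, hτ⟩ := MonoidHom.mem_range.mp hmem
  have hτ' : absGaloisRestrict ℚ K τ = c₀⁻¹ * h := hτ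
  refine ⟨v₁, g • 𝔓', h, c₀, hℓv₁, smul_mem_primesAbove h𝔓' g, hhFrob, hc₀, hhP, fun e x ↦ ?_⟩
  have hh' : h = c₀ * absGaloisRestrict ℚ K τ := by rw [hτ', mul_inv_cancel_left]
  rw [hh', mul_smul, absGaloisRestrict_smul_apply_eq τ e x]

/-- **The pair consumed by the end files** at a Zhang–Kolyvagin prime of index `≥ M`:
`IsKolyvaginPrime N_E W K p ℓ ∧ FrobEqFrobInfty W K (p^M) ℓ`. [cite: GrossLMS1991, §3 (3.1)–(3.3)]
[cite: WZhang2014, Notations (xii)] -/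
theorem isKolyvaginPrime_and_frobEqFrobInfty_pow_of_zhang (hK : IsImaginaryQuadratic K) {p : ℕ}
    [Fact p.Prime] (hp2 : p ≠ 2) {M : ℕ} (hM : 1 ≤ M) (hsurj : W.HasSurjectiveModNGaloisRep p)
    (hsurjM : W.HasSurjectiveModNGaloisRep (p ^ M : ℕ)) {ℓ : ℕ}
    (hℓ : Zhang2014.IsKolyvaginPrime (W.conductorNorm ℤ) W K p ℓ)
    (hℓM : M ≤ Zhang2014.kolyvaginIndex W p ℓ) :
    IsKolyvaginPrime (W.conductorNorm ℤ) W K p ℓ ∧ FrobEqFrobInfty W K (p ^ M) ℓ :=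
  ⟨isKolyvaginPrime_of_zhang W K hK hp2 hsurj hℓ,
    frobEqFrobInfty_pow_of_zhang W K hK hp2 hM hsurjM hℓ hℓM⟩

end Gross

end Literature.NumberTheory.EllipticCurves.McCallum1991.LeafProofs

end Part3

/-!
## Part 4 — port of `Summits/BirchSwinnertonDyer/BirchSwinnertonDyer/Theorems/KolyvaginDepthDoorKolyvaginDepthSupplyLeafReciprocityPow.lean` (1 declarations kept)

# `McCallum1991.prop22_reciprocity_eigen_finset` (McCallum 1991 Prop. 2.2 with Lemma 5.3 at a finite set of Kolyvagin places, level `p^M`)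

Declarations of this Part (verbatim port; each keeps its own docstring and citation): `prop22_reciprocity_eigen_finset_holds`.

Reference keys (see `references.bib` and the declarations' citations): [McCallumLMS1991], [GrossLMS1991], [MilneADT2006].
-/

section Part4

open scoped _root_.Classical _root_.Pointwise

namespace Literature.NumberTheory.EllipticCurves.McCallum1991.LeafProofs

open _root_.WeierstrassCurve _root_.NumberField _root_.IsDedekindDomain _root_.Field
open Literature.NumberTheory.EllipticCurves Literature.NumberTheory.EllipticCurves.ModularForms
open Literature.NumberTheory.EllipticCurves.McCallum1991
open Literature.NumberTheory.GaloisRepresentations Literature.NumberTheory.GaloisCohomology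
open Literature.NumberTheory.EllipticCurves.McCallum1991.AuxPrimes

/-- **LEAF 5 DISCHARGED: `McCallum1991.prop22_reciprocity_eigen_finset` HOLDS** (McCallum 1991
Prop. 2.2 *"`∑_v inv_v(c_v ∪ c'_v) = 0`"* used as in the proof of Prop. 5.2 and read at `λ` through
Lemma 5.3, at every level `p^M`: for a finite set `T` of Zhang–Kolyvagin primes of index `≥ M`,
`ℓ ∈ T`, a `ν`-eigenclass `d ∈ H¹(K, E[p^M])` Selmer off the places of `T` and at infinity, and
`s ∈ Sel_{p^M}(E/K)^ν` vanishing at the places of `T ∖ {ℓ}`: `ord(s_λ)·ord(d_λ) ≤ p^M`, i.e.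
`p^a d_λ ≠ 0 ⟹ p^{M−1−a} s_λ = 0`). Proof: module docstring. Unconditional.
[cite: McCallumLMS1991, §2 Prop. 2.2, §5 Lemma 5.3, proof of Prop. 5.2 (p. 306)]
[cite: GrossLMS1991, §3 (3.2), §8 Prop. 8.2] [cite: MilneADT2006, Ch. I Thm. 4.10(b)] -/
theorem _root_.Literature.NumberTheory.EllipticCurves.McCallum1991.prop22_reciprocity_eigen_finset_holds : prop22_reciprocity_eigen_finset := by
  intro W _ _ _ _hcm K _ _ hK p _ hp2 htower c hc M hM T hT ℓ hℓT ν hν d hd hdfin hdinf s hs hτs hsT v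
    hv a ha hdv
  have hp : p.Prime := Fact.out
  by_contra hsv
  -- Zhang ⟹ Gross at every prime of `T`, at level `p^M`
  have hρ : W.HasSurjectiveModNGaloisRep p := by simpa only [pow_one] using htower 1
  have hG : ∀ r ∈ T, IsKolyvaginPrime (W.conductorNorm ℤ) W K p r := fun r hr ↦
    Literature.NumberTheory.EllipticCurves.McCallum1991.ZhangGross.isKolyvaginPrime_of_zhang W K hK hp2 hρ
      (hT r hr).1
  have hℓG : IsKolyvaginPrime (W.conductorNorm ℤ) W K p ℓ := hG ℓ hℓT
  have hfrob : FrobEqFrobInfty W K (p ^ M) ℓ :=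
    frobEqFrobInfty_pow_of_zhang W K hK hp2 hM (htower M) (hT ℓ hℓT).1 (hT ℓ hℓT).2
  have hveq : v = hℓG.place := hℓG.mem_iff.mp hv
  subst hveq
  -- good reduction of `E/K` at `λ`: `ℓ ∤ N_E`
  have hgood : (W.baseChange K).HasGoodReductionAt hℓG.place := by
    haveI : hℓG.place.asIdeal.LiesOver (hℓG.place.under (𝓞 ℚ)).asIdeal := ⟨rfl⟩
    exact hasGoodReductionAt_baseChange_of_hasGoodReductionAt_rat W (hℓG.place.under (𝓞 ℚ))
      hℓG.place (LocalFrob.hasGoodReductionAt_rat_of_not_dvd_conductorNorm W hℓG.prime hℓG.2.1 _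
        hℓG.natCast_mem_under)
  -- (R)_M against `s` vanishing on the places of `T ∖ {ℓ}`, from the Poitou–Tate theorem
  obtain ⟨A, _, eA, halt, hnd, hR⟩ :=
    kolyvaginReciprocityFinset_of_poitouTate_of_hasGoodReductionAt (W.conductorNorm ℤ) W K
      (poitouTate_sum_localTatePairing_eq_zero_holds K) hp hM hℓG hgood
  let T' : Finset (HeightOneSpectrum (𝓞 K)) :=
    (T.erase ℓ).attach.image fun r ↦ (hG r.1 (Finset.mem_of_mem_erase r.2)).place
  have hsT' : ∀ v' ∈ T', s ∈ (W.baseChange K).torsionLocalKer (v'.adicCompletion K)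
      ((p ^ M : ℕ) : ℤ) := by
    intro v' hv'
    obtain ⟨r, -, rfl⟩ := Finset.mem_image.mp hv'
    obtain ⟨hrℓ, hrT⟩ := Finset.mem_erase.mp r.2
    exact hsT r.1 hrT hrℓ _ (hG r.1 hrT).mem_place
  have hdfin' : ∀ v' : HeightOneSpectrum (𝓞 K), v' ∉ T' → (ℓ : 𝓞 K) ∉ v'.asIdeal →
      d ∈ selmerLocalKer (W.baseChange K) (v'.adicCompletion K) ((p ^ M : ℕ) : ℤ) := by
    intro v' hv'T hℓv'
    refine hdfin v' fun r hr hrv' ↦ ?_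
    by_cases hrℓ : r = ℓ
    · exact hℓv' (hrℓ ▸ hrv')
    · apply hv'T
      have hv'eq : v' = (hG r hr).place := (hG r hr).mem_iff.mp hrv'
      exact Finset.mem_image.mpr ⟨⟨r, Finset.mem_erase.mpr ⟨hrℓ, hr⟩⟩, Finset.mem_attach _ _,
        hv'eq.symm⟩
  have hRd := hR T' s hs hsT' d hdfin' hdinf
  -- McCallum's Lemma 5.3 with Prop. 2.2 at level `p^M`
  have hdv' : ((p : ℤ) ^ a) • d ∉
      selmerLocalKer (W.baseChange K) (hℓG.place.adicCompletion K) ((p ^ M : ℕ) : ℤ) := by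
    rw [← Nat.cast_pow]; exact hdv
  have h53 := lemma_5_3_descent_of_reciprocity W hK hp hp2 hc hℓG hM (q := p ^ M) rfl hfrob hgood eA
    halt hnd hν hd hdv' hs hτs hRd
  rw [← Nat.cast_pow] at h53
  exact hsv h53

end Literature.NumberTheory.EllipticCurves.McCallum1991.LeafProofs

end Part4

/-!
## Part 5 — port of `Summits/BirchSwinnertonDyer/BirchSwinnertonDyer/Theorems/KolyvaginDepthDoorKolyvaginDepthSupplyLeafEigenLinePow.lean` (4 declarations kept)

# `McCallum1991.lemma53_selmer_eigen_dependent_at` (McCallum 1991 Lemma 5.3 / Gross 1991 Prop. 8.1 (1) at level `p^M`: two Selmer `ν`-eige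

Declarations of this Part (verbatim port; each keeps its own docstring and citation): `exists_pow_dvd_mul_sub`, `exists_zsmul_add_zsmul_eq_zero_of_mem_zmultiples`, `exists_zsmul_add_zsmul_mem_torsionLocalKer_of_eigen_pow`, `lemma53_selmer_eigen_dependent_at_holds`.

Reference keys (see `references.bib` and the declarations' citations): [McCallumLMS1991], [GrossLMS1991], [WZhang2014].
-/

section Part5

open scoped _root_.Classical _root_.Pointwise

namespace Literature.NumberTheory.EllipticCurves.McCallum1991.LeafProofs

open _root_.WeierstrassCurve _root_.NumberField _root_.IsDedekindDomain _root_.Field WithZero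
open Literature.NumberTheory.EllipticCurves Literature.NumberTheory.EllipticCurves.McCallum1991
open Literature.NumberTheory.GaloisRepresentations
open Literature.NumberTheory.EllipticCurves.McCallum1991.AuxPrimes

universe u

/-! ## Two elements of a cyclic `p`-group are dependent modulo `p` -/

section Cyclic

variable {A : Type*} [AddCommGroup A]

/-- Bézout: for `α = p^e α'` with `p ∤ α'` and `β = p^e β''` there is `γ` with `p^M ∣ γ α − β`.
[cite: McCallumLMS1991, §5 Lemma 5.3 (p. 304)] -/
theorem exists_pow_dvd_mul_sub {p : ℕ} (hp : p.Prime) (M : ℕ) {e : ℕ} {α' β'' : ℤ}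
    (hα' : ¬ (p : ℤ) ∣ α') :
    ∃ γ : ℤ, ((p : ℤ) ^ M) ∣ γ * ((p : ℤ) ^ e * α') - (p : ℤ) ^ e * β'' := by
  have hcop : IsCoprime α' ((p : ℤ) ^ M) := by
    refine IsCoprime.pow_right ?_
    rw [Int.isCoprime_iff_gcd_eq_one, Int.gcd_comm]
    have h1 : Int.gcd (p : ℤ) α' = Nat.gcd p α'.natAbs := by simp [Int.gcd]
    rw [h1]
    exact (Nat.Prime.coprime_iff_not_dvd hp).mpr (fun h ↦ hα' (Int.natCast_dvd.mpr h))
  obtain ⟨u, v, huv⟩ := hcop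
  refine ⟨β'' * u, ⟨-((p : ℤ) ^ e * β'' * v), ?_⟩⟩
  linear_combination ((p : ℤ) ^ e * β'') * huv

/-- **Two elements of a cyclic group `ℤ g` with `p^M g = 0` satisfy `a x₁ + b x₂ = 0` with
`(a, b) ≢ (0, 0) (mod p)`**: `xᵢ = αᵢ g`; at the index of smaller `v_p(αᵢ)`, `αᵢ = p^e α'`,
`α_j = p^e β''`, `γ αᵢ ≡ α_j (mod p^M)` with `γ = β'' α'^{-1}`, so `γ xᵢ − x_j = 0`. [cite: McCallumLMS1991, §5 Lemma 5.3 (p. 304)] -/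
theorem exists_zsmul_add_zsmul_eq_zero_of_mem_zmultiples {p : ℕ} (hp : p.Prime) {M : ℕ} {g : A}
    (hg : p ^ M • g = 0) {x₁ x₂ : A} (h₁ : x₁ ∈ AddSubgroup.zmultiples g)
    (h₂ : x₂ ∈ AddSubgroup.zmultiples g) :
    ∃ a b : ℤ, ¬ ((p : ℤ) ∣ a ∧ (p : ℤ) ∣ b) ∧ a • x₁ + b • x₂ = 0 := by
  haveI : Fact p.Prime := ⟨hp⟩
  have hp1 : ¬ (p : ℤ) ∣ 1 := fun h ↦ hp.one_lt.ne' (by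
    have := Int.eq_one_of_dvd_one (Int.natCast_nonneg p) h
    exact_mod_cast this)
  have hpm1 : ¬ (p : ℤ) ∣ -1 := fun h ↦ hp1 (dvd_neg.mp h)
  have hgM : ((p : ℤ) ^ M) • g = 0 := by rw [← Nat.cast_pow, natCast_zsmul]; exact hg
  obtain ⟨α, rfl⟩ := AddSubgroup.mem_zmultiples_iff.mp h₁
  obtain ⟨β, rfl⟩ := AddSubgroup.mem_zmultiples_iff.mp h₂
  have hrel : ∀ {α β γ : ℤ}, ((p : ℤ) ^ M) ∣ γ * α - β → γ • α • g + (-1 : ℤ) • β • g = 0 := by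
    intro α β γ ⟨k, hk⟩
    rw [smul_smul, smul_smul, ← add_smul, show γ * α + -1 * β = γ * α - β by ring, hk, mul_comm,
      mul_smul, hgM, smul_zero]
  by_cases hα : α = 0
  · exact ⟨1, 0, fun h ↦ hp1 h.1, by rw [hα]; simp⟩
  by_cases hβ : β = 0
  · exact ⟨0, 1, fun h ↦ hp1 h.2, by rw [hβ]; simp⟩
  have hdec : ∀ {α : ℤ}, α ≠ 0 → ∃ α' : ℤ, α = (p : ℤ) ^ padicValInt p α * α' ∧ ¬ (p : ℤ) ∣ α' := by
    intro α hα0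
    obtain ⟨α', hα'⟩ := (padicValInt_dvd_iff (padicValInt p α) α).mpr (Or.inr le_rfl)
    refine ⟨α', hα', fun ⟨t, ht⟩ ↦ ?_⟩
    have hdvd : (p : ℤ) ^ (padicValInt p α + 1) ∣ α := ⟨t, by
      conv_lhs => rw [hα', ht]
      ring⟩
    rcases (padicValInt_dvd_iff _ α).mp hdvd with h0 | hle
    · exact hα0 h0
    · omega
  rcases le_total (padicValInt p α) (padicValInt p β) with hle | hle
  · obtain ⟨α', hα', hα'p⟩ := hdec hα
    obtain ⟨β'', hβ''⟩ := (padicValInt_dvd_iff (padicValInt p α) β).mpr (Or.inr hle)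
    obtain ⟨γ, hγ⟩ := exists_pow_dvd_mul_sub hp M (e := padicValInt p α) (β'' := β'') hα'p
    rw [← hα', ← hβ''] at hγ
    exact ⟨γ, -1, fun h ↦ hpm1 h.2, hrel hγ⟩
  · obtain ⟨β', hβ', hβ'p⟩ := hdec hβ
    obtain ⟨α'', hα''⟩ := (padicValInt_dvd_iff (padicValInt p β) α).mpr (Or.inr hle)
    obtain ⟨γ, hγ⟩ := exists_pow_dvd_mul_sub hp M (e := padicValInt p β) (β'' := α'') hβ'p
    rw [← hβ', ← hα''] at hγ
    refine ⟨-1, γ, fun h ↦ hpm1 h.1, ?_⟩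
    rw [add_comm]; exact hrel hγ

end Cyclic

/-! ## Two Selmer `ν`-eigenclasses are dependent at a Kolyvagin place of level `M` -/

section Gross

variable {K : Type u} [Field K] [NumberField K] (W : WeierstrassCurve ℚ)

/-- **McCallum 1991 Lemma 5.3 / Gross 1991 Prop. 8.1 (1) for global classes at LEVEL `p^M`, PROVED:
two `ν`-eigenclasses `s₁, s₂ ∈ H¹(K, E[p^M])` satisfying the Selmer condition at the Kolyvagin place
`λ` (of level `M`: `Frob(ℓ) = Frob(∞)` in `Gal(K(E[p^M])/ℚ)`, good reduction at `λ`) admit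
`a, b ∈ ℤ`, not both divisible by `p`, with `a s₁ + b s₂ = 0` in `H¹(K_λ, E[p^M])`.** Proof: module
docstring (Steps 0–4, 8 of the tree's `lemma_5_3_descent_of_reciprocity`, then
`exists_zsmul_add_zsmul_eq_zero_of_mem_zmultiples` in the cyclic `ν`-eigen-part of `E_{p^M}`, then
Gross's Prop. 9.6 transported to the prime of the embedding).
[cite: McCallumLMS1991, §5 Lemma 5.3 (p. 304)] [cite: GrossLMS1991, §8 Prop. 8.1 (1), §9 Prop. 9.6] -/
theorem exists_zsmul_add_zsmul_mem_torsionLocalKer_of_eigen_pow [W.IsElliptic]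
    (hK : IsImaginaryQuadratic K) {p : ℕ} (hp : p.Prime) (hp2 : p ≠ 2) {c : K ≃ₐ[ℚ] K} (hc : c ≠ 1)
    {N ℓ : ℕ} (hℓ : IsKolyvaginPrime N W K p ℓ) {M : ℕ} (hM : 1 ≤ M) {q : ℕ} (hq : q = p ^ M)
    (hℓM : FrobEqFrobInfty W K q ℓ)
    (hgood : (W.baseChange K).HasGoodReductionAt hℓ.place)
    {ν : ℤ} (hν : ν = 1 ∨ ν = -1)
    {s₁ s₂ : galH1Torsion (W.baseChange K) (q : ℤ)}
    (hs₁ : s₁ ∈ selmerLocalKer (W.baseChange K) (hℓ.place.adicCompletion K) (q : ℤ))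
    (hτ₁ : conjAct W c (q : ℤ) s₁ = ν • s₁)
    (hs₂ : s₂ ∈ selmerLocalKer (W.baseChange K) (hℓ.place.adicCompletion K) (q : ℤ))
    (hτ₂ : conjAct W c (q : ℤ) s₂ = ν • s₂) :
    ∃ a b : ℤ, ¬ ((p : ℤ) ∣ a ∧ (p : ℤ) ∣ b) ∧
      a • s₁ + b • s₂ ∈ (W.baseChange K).torsionLocalKer (hℓ.place.adicCompletion K) (q : ℤ) := by
  classical
  haveI : Fact p.Prime := ⟨hp⟩
  haveI : Algebra.IsQuadraticExtension ℚ K := ⟨hK.1⟩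
  haveI : IsTotallyComplex K := hK.2
  set w := hℓ.place with hwdef
  have hℓprime : ℓ.Prime := hℓ.prime
  have hq0 : q ≠ 0 := by rw [hq]; exact pow_ne_zero M hp.ne_zero
  have hq0Z : (q : ℤ) ≠ 0 := by exact_mod_cast hq0
  -- ### Step 0: `p, q ∉ λ`, `λ` good, `#E_q = q²`, `q E_q = 0`
  have hpw' : (p : 𝓞 K) ∉ w.asIdeal :=
    not_natCast_mem_of_prime_ne hℓprime hp hℓ.2.2.2.1 w hℓ.mem_place
  have hqw' : (q : 𝓞 K) ∉ w.asIdeal := by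
    rw [hq, Nat.cast_pow]
    exact fun h ↦ hpw' (w.isPrime.mem_of_pow_mem M h)
  have hqw : (((q : ℕ) : ℤ) : 𝓞 K) ∉ w.asIdeal := by rwa [Int.cast_natCast]
  have hwbad : w ∉ (W.baseChange K).badPlaces (𝓞 K) := fun h ↦ h hgood
  have hTq : ∀ P : geomTorsion (W.baseChange K) q, q • P = 0 := fun P ↦ by
    have := (mem_geomTorsion_iff (W.baseChange K) q _).mp P.2
    apply Subtype.ext
    rw [AddSubgroupClass.coe_nsmul, ← natCast_zsmul]
    exact this
  have hcardK : Nat.card (geomTorsion (W.baseChange K) q) = q ^ 2 :=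
    card_torsionPoints_eq_sq_holds (W.baseChange K) (AlgebraicClosure K)
      (by exact_mod_cast hq0)
  -- ### Step 1: the Frobenius data of (3.2)
  obtain ⟨v, 𝔓₀, h, c₀, hℓv, h𝔓₀, hh, hc₀, hE, hKact⟩ := hℓM
  have hHi := index_range_absGaloisRestrict_eq_finrank ℚ K
  haveI hHn : ((absGaloisRestrict ℚ K).range).Normal :=
    Subgroup.normal_of_index_eq_two (hHi.trans hK.1)
  set e₀ : K →ₐ[ℚ] AlgebraicClosure ℚ :=
    (Literature.NumberTheory.EllipticCurves.absClosureEquiv ℚ K).symm.toAlgHom.comp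
      (IsScalarTower.toAlgHom ℚ K (AlgebraicClosure K)) with he₀
  have he₀x : ∀ x : K, e₀ x = (Literature.NumberTheory.EllipticCurves.absClosureEquiv ℚ K).symm
      (algebraMap K (AlgebraicClosure K) x) := fun _ ↦ rfl
  have hrange : ∀ γ : absoluteGaloisGroup ℚ,
      γ ∈ Set.range (absGaloisRestrict ℚ K) ↔ ∀ x : K, γ • e₀ x = e₀ x := fun γ ↦ by
    rw [mem_range_absGaloisRestrict_iff]
    refine forall_congr' fun x ↦ ?_
    rw [absGaloisTransport_apply, he₀x]
    constructor
    · intro h1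
      apply (Literature.NumberTheory.EllipticCurves.absClosureEquiv ℚ K).injective
      rw [AlgEquiv.apply_symm_apply]
      exact h1
    · intro h1
      rw [h1, AlgEquiv.apply_symm_apply]
  have hc₀H : c₀ ∉ Set.range (absGaloisRestrict ℚ K) :=
    hc₀.not_mem_range_absGaloisRestrict (L := K) IsTotallyComplex.isComplex
  have hhH : h ∉ (absGaloisRestrict ℚ K).range := by
    intro hmem
    have hmem' : h ∈ Set.range (absGaloisRestrict ℚ K) := hmem
    apply hc₀H
    rw [hrange]
    intro x
    rw [← hKact e₀ x]
    exact (hrange h).mp hmem' x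
  -- ### Step 2: `ℓ` unramified; the prime `𝔔 ∣ λ` and the Frobenius `τ'` with `res τ' = h²`
  have hunr : Algebra.IsUnramifiedIn (𝓞 K) v.asIdeal :=
    isUnramifiedIn_of_span_natCast_isPrime hℓprime hℓ.2.2.2.2.1 hℓv
  have hIr := inertia_le_range_absGaloisRestrict_of_isUnramifiedIn (K := K) hunr h𝔓₀
  obtain ⟨w', 𝔔, τ', hw'v, -, -, h𝔔w, -, hτ', hresτ'⟩ :=
    exists_place_inert_of_not_mem_range (F := ℚ) (M := K) (hK.1 ▸ Nat.prime_two) hHn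
      (hHi.trans rfl) hunr h𝔓₀ hIr hh hhH
  have hℓw' : (ℓ : 𝓞 K) ∈ w'.asIdeal := by
    have h1 : (ℓ : 𝓞 ℚ) ∈ (w'.under (𝓞 ℚ)).asIdeal := by rw [hw'v]; exact hℓv
    rw [HeightOneSpectrum.under_asIdeal, Ideal.under_def, Ideal.mem_comap, map_natCast] at h1
    exact h1
  have hw'w : w' = w := hℓ.mem_iff.mp hℓw'
  subst hw'w
  rw [hK.1] at hresτ'
  haveI : 𝔔.IsPrime := h𝔔w.1
  -- ### Step 3: the lift `T = e h e⁻¹` of `c`; `τ'` acts on `K̄` as `T²` and fixes `E_q`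
  set T := (absGaloisTransport (K := ℚ) (L := K)) h with hTdef
  have hTne : T.restrictNormal K ≠ 1 := by
    intro h1
    apply hhH
    change h ∈ Set.range (absGaloisRestrict ℚ K)
    rw [mem_range_absGaloisRestrict_iff]
    intro x
    have hx := AlgEquiv.restrictNormal_commutes T K x
    rw [h1, AlgEquiv.one_apply] at hx
    exact hx.symm
  have ht : IsLiftOfAut c T.toRingEquiv := by
    have hcard : Nat.card (K ≃ₐ[ℚ] K) = 2 := by rw [IsGalois.card_aut_eq_finrank, hK.1]
    obtain ⟨y, -, hy⟩ := (Nat.card_eq_two_iff' (1 : K ≃ₐ[ℚ] K)).mp hcard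
    rw [hy c hc, ← hy _ hTne]
    exact RatClosure.isLiftOfAut_restrictNormal_absGaloisTransport h
  have hτ'T : ∀ y : AlgebraicClosure K, (τ' : absoluteGaloisGroup K) • y = T (T y) := fun y ↦ by
    rw [← absGaloisTransport_absGaloisRestrict (K := ℚ) τ' y, hresτ', map_pow, pow_two,
      AlgEquiv.mul_apply]
  have hτ'fix : τ' ∈ torsionFixing (W.baseChange K) q := by
    rw [mem_torsionFixing_iff]
    intro Q
    obtain ⟨P, rfl⟩ := (RatClosure.torsionEquiv (K := K) W (q : ℤ)).surjective Q
    rw [← RatClosure.torsionEquiv_smul W q τ' P, hresτ', pow_two, mul_smul, hE, hE,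
      ← mul_smul, ← pow_two, hc₀.sq_eq_one, one_smul]
  -- ### Step 4: `conj_T τ' = τ'` and `T_*[sᵢ, τ'] = ν [sᵢ, τ']`
  have hconjτ' : ht.conjGalCMH τ' = τ' := by
    refine AlgEquiv.ext fun y ↦ ?_
    change ht.conjGal τ' y = _
    rw [ht.conjGal_apply]
    change T.symm ((τ' : absoluteGaloisGroup K) • (T y)) = (τ' : absoluteGaloisGroup K) • y
    rw [hτ'T, hτ'T, AlgEquiv.symm_apply_apply]
  have hs₁_eigen : ht.torsionMap W q (h1Eval (W.baseChange K) q s₁ τ') =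
      ν • h1Eval (W.baseChange K) q s₁ τ' :=
    torsionMap_h1Eval_eq_of_conjAct_eq W ht q hτ'fix hconjτ' hτ₁
  have hs₂_eigen : ht.torsionMap W q (h1Eval (W.baseChange K) q s₂ τ') =
      ν • h1Eval (W.baseChange K) q s₂ τ' :=
    torsionMap_h1Eval_eq_of_conjAct_eq W ht q hτ'fix hconjτ' hτ₂
  -- ### Step 8: `E_q = E_q⁺ ⊕ E_q⁻` with both parts cyclic of order `q` (McCallum Lemma 5.3)
  set ι := ht.torsionMap W q with hιdef
  set θq := RatClosure.torsionEquiv (K := K) W (q : ℤ) with hθq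
  have hιθ : ∀ P : geomTorsion W q, ι (θq P) = θq (c₀ • P) := fun P ↦ by
    rw [← hE, ← RatClosure.torsionEquiv_smul_of_lift W ht h (fun _ ↦ rfl) q P]
  have hιinv : ∀ Q, ι (ι Q) = Q := fun Q ↦ by
    obtain ⟨P, rfl⟩ := θq.surjective Q
    rw [hιθ, hιθ, ← mul_smul, ← pow_two, hc₀.sq_eq_one, one_smul]
  have hpq : p ∣ q := hq ▸ dvd_pow_self p (by omega)
  have hEp : ∀ P : geomTorsion W p, h • P = c₀ • P := fun P ↦ by
    have hPq : ((q : ℕ) : ℤ) • (P : geomPoints W) = 0 := by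
      obtain ⟨m, hm⟩ := hpq
      rw [hm, Nat.cast_mul, mul_comm, mul_smul, (mem_geomTorsion_iff W p _).mp P.2, smul_zero]
    have h1 := congrArg Subtype.val (hE ⟨P.1, (mem_geomTorsion_iff W q _).mpr hPq⟩)
    rw [AddSubgroup.torsionBy.coe_smul, AddSubgroup.torsionBy.coe_smul] at h1
    apply Subtype.ext
    rw [AddSubgroup.torsionBy.coe_smul, AddSubgroup.torsionBy.coe_smul]
    exact h1
  obtain ⟨⟨e₁, he₁0, he₁⟩, ⟨e₂, he₂0, he₂⟩⟩ :=
    RatClosure.exists_eigenvectors W hc₀ (W.exists_weilPairing_holds p) hp2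
  set θp := RatClosure.torsionEquiv (K := K) W (p : ℤ) with hθp
  have hinclmem : ∀ Q : geomTorsion (W.baseChange K) p,
      ((q : ℕ) : ℤ) • (Q : geomPoints (W.baseChange K)) = 0 := fun Q ↦ by
    obtain ⟨m, hm⟩ := hpq
    rw [hm, Nat.cast_mul, mul_comm, mul_smul, (mem_geomTorsion_iff _ p _).mp Q.2, smul_zero]
  set incl : geomTorsion (W.baseChange K) p → geomTorsion (W.baseChange K) q :=
    fun Q ↦ ⟨Q.1, (mem_geomTorsion_iff _ q _).mpr (hinclmem Q)⟩ with hincl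
  have hincl_inj : Function.Injective incl := fun Q Q' hQ ↦ Subtype.ext
    (congrArg (fun R : geomTorsion (W.baseChange K) (q : ℤ) ↦ (R : geomPoints (W.baseChange K)))
      hQ)
  have hincl0 : incl 0 = 0 := Subtype.ext rfl
  have hincl_neg : ∀ Q, incl (-Q) = -incl Q := fun Q ↦ Subtype.ext rfl
  have hincl_p : ∀ Q, p • incl Q = 0 := fun Q ↦ Subtype.ext (by
    rw [AddSubgroupClass.coe_nsmul, ZeroMemClass.coe_zero]
    change p • (Q : geomPoints (W.baseChange K)) = 0
    rw [← natCast_zsmul]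
    exact (mem_geomTorsion_iff _ p _).mp Q.2)
  have hιincl : ∀ Q, ι (incl Q) = incl (ht.torsionMap W p Q) := fun Q ↦ by
    apply Subtype.ext
    simp only [hincl, hιdef, IsLiftOfAut.coe_torsionMap]
  have hθpT : ∀ P : geomTorsion W p, ht.torsionMap W p (θp P) = θp (c₀ • P) := fun P ↦ by
    rw [← hEp, ← RatClosure.torsionEquiv_smul_of_lift W ht h (fun _ ↦ rfl) p P]
  set v₁ := incl (θp e₁) with hv₁def
  set v₂ := incl (θp e₂) with hv₂def
  have hv₁ : ι v₁ = v₁ := by rw [hv₁def, hιincl, hθpT, he₁]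
  have hv₂ : ι v₂ = -v₂ := by rw [hv₂def, hιincl, hθpT, he₂, map_neg, hincl_neg]
  have hv₁0 : v₁ ≠ 0 := fun h0 ↦ he₁0 (θp.injective (hincl_inj (by
    rw [map_zero, hincl0]; exact h0)))
  have hv₂0 : v₂ ≠ 0 := fun h0 ↦ he₂0 (θp.injective (hincl_inj (by
    rw [map_zero, hincl0]; exact h0)))
  have hcardKp : Nat.card (geomTorsion (W.baseChange K) p) = p ^ 2 :=
    card_torsionPoints_eq_sq_holds (W.baseChange K) (AlgebraicClosure K)
      (by exact_mod_cast hp.ne_zero)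
  have hcardp : Nat.card {x : geomTorsion (W.baseChange K) q // p • x = 0} = p ^ 2 := by
    refine Eq.trans (Nat.card_congr ?_) hcardKp
    exact
      { toFun := fun x ↦ ⟨x.1.1, (mem_geomTorsion_iff _ p _).mpr (by
          have h1 := congrArg Subtype.val x.2
          rw [AddSubgroupClass.coe_nsmul, ZeroMemClass.coe_zero, ← natCast_zsmul] at h1
          exact h1)⟩
        invFun := fun Q ↦ ⟨incl Q, hincl_p Q⟩
        left_inv := fun x ↦ Subtype.ext (Subtype.ext rfl)
        right_inv := fun Q ↦ Subtype.ext rfl }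
  have hcardT : Nat.card (geomTorsion (W.baseChange K) q) = p ^ (2 * M) := by
    rw [hcardK, hq, ← pow_mul, mul_comm]
  have hTp' : ∀ t : geomTorsion (W.baseChange K) q, p ^ M • t = 0 := fun t ↦ by
    rw [← hq]; exact hTq t
  haveI : Finite (geomTorsion (W.baseChange K) q) :=
    Nat.finite_of_card_ne_zero (by rw [hcardT]; exact pow_ne_zero _ hp.ne_zero)
  obtain ⟨u₀, w₀, -, -, hPu, hQw, -, hou, how⟩ :=
    KolyvaginEigenPow.exists_eigen_generators hp hp2 hTp' hcardT hcardp ι hιinv hv₁0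
      (hincl_p _) hv₁ hv₂0 (hincl_p _) hv₂
  set x₁ := h1Eval (W.baseChange K) q s₁ τ' with hx₁def
  set x₂ := h1Eval (W.baseChange K) q s₂ τ' with hx₂def
  obtain ⟨a, b, hab, hrel⟩ : ∃ a b : ℤ, ¬ ((p : ℤ) ∣ a ∧ (p : ℤ) ∣ b) ∧ a • x₁ + b • x₂ = 0 := by
    rcases hν with rfl | rfl
    · rw [one_smul] at hs₁_eigen hs₂_eigen
      exact exists_zsmul_add_zsmul_eq_zero_of_mem_zmultiples hp (hTp' u₀) (hPu x₁ hs₁_eigen)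
        (hPu x₂ hs₂_eigen)
    · rw [neg_one_zsmul] at hs₁_eigen hs₂_eigen
      exact exists_zsmul_add_zsmul_eq_zero_of_mem_zmultiples hp (hTp' w₀) (hQw x₁ hs₁_eigen)
        (hQw x₂ hs₂_eigen)
  refine ⟨a, b, hab, ?_⟩
  set s' := a • s₁ + b • s₂ with hs'def
  have hs' : s' ∈ selmerLocalKer (W.baseChange K) (w.adicCompletion K) (q : ℤ) :=
    AddSubgroup.add_mem _ (AddSubgroup.zsmul_mem _ hs₁ a) (AddSubgroup.zsmul_mem _ hs₂ b)
  have hxs' : h1Eval (W.baseChange K) q s' τ' = 0 := by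
    rw [hs'def, h1Eval_add _ _ _ _ hτ'fix, h1Eval_zsmul _ _ _ _ hτ'fix, h1Eval_zsmul _ _ _ _ hτ'fix,
      ← hx₁def, ← hx₂def, hrel]
  haveI : CharZero (w.adicCompletion K) :=
    charZero_of_injective_algebraMap (algebraMap K (w.adicCompletion K)).injective
  obtain ⟨𝔐, h𝔐⟩ := w.localPrimesAbove_nonempty
  set 𝔓w := w.primeBelow (closureEmb (K := K) (w.adicCompletion K)) 𝔐 with h𝔓wdef
  have h𝔓w : 𝔓w ∈ w.primesAbove := HeightOneSpectrum.primeBelow_mem_primesAbove h𝔐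
  obtain ⟨δ, -, hF⟩ :=
    HeightOneSpectrum.exists_isArithFrobAt_conj_of_mem_primesAbove_holds h𝔔w h𝔓w hτ'
  have hFT : δ * τ' * δ⁻¹ ∈ torsionFixing (W.baseChange K) q :=
    (torsionFixing_normal (W.baseChange K) q).conj_mem _ hτ'fix δ
  have hsunr : s' ∈ unramifiedKer (geomTorsion (W.baseChange K) q) 𝔓w :=
    selmerLocalKer_le_unramifiedKer (HeightOneSpectrum.exists_mem_inertia_apply_eq_holds w)
      (W.baseChange K).smul_localPoints_eq_of_mem_inertia_holds hwbad hqw h𝔓w hs'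
  have hcrit := mem_torsionLocalKer_iff_h1Eval_eq_zero (W.baseChange K) (q : ℤ) h𝔐 hF hFT
    (inertia_le_torsionFixing (W.baseChange K) hwbad hqw _ h𝔐)
    (isOpen_torsionFixing (W.baseChange K) hq0Z)
    (torsionPointsMap_bijective (W.baseChange K) (w.adicCompletion K) hq0).2 hsunr
  change s' ∈ _
  rw [hcrit, h1Eval_conj (W.baseChange K) q s' δ hτ'fix, hxs', smul_zero]

end Gross

section Leaf

/-- **LEAF 4 DISCHARGED: `McCallum1991.lemma53_selmer_eigen_dependent_at` HOLDS** (McCallum 1991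
Lemma 5.3 *"a duality of cyclic groups of order `p^M`"* / Gross 1991 Prop. 8.1 (1), recorded as: two
classes of `Sel_{p^M}(E/K)` in one eigenspace of complex conjugation are dependent in
`H¹(K_λ, E_{p^M})` at a Zhang–Kolyvagin prime of index `≥ M`). Proof:
`exists_zsmul_add_zsmul_mem_torsionLocalKer_of_eigen_pow` at Gross's currency, reached from Zhang's by
`isKolyvaginPrime_and_frobEqFrobInfty_pow_of_zhang` (tower surjectivity at `1` and `M`), good
reduction at `ℓ ∤ N_E` (`LocalFrob.hasGoodReductionAt_rat_of_not_dvd_conductorNorm`, base-changed),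
`v = λ` by `IsKolyvaginPrime.mem_iff`. Unconditional; the leaf's `¬ CM` binder is idle.
[cite: McCallumLMS1991, §5 Lemma 5.3 (p. 304)] [cite: GrossLMS1991, §8 Prop. 8.1 (1)]
[cite: WZhang2014, Notations (xii)] -/
theorem _root_.Literature.NumberTheory.EllipticCurves.McCallum1991.lemma53_selmer_eigen_dependent_at_holds : lemma53_selmer_eigen_dependent_at := by
  intro W _ _ _ _hcm K _ _ hK p _ hp2 htower c hc M hM ℓ hℓ hℓM ν hν s₁ hs₁ hτ₁ s₂ hs₂ hτ₂
  have hp : p.Prime := Fact.out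
  have hρ : W.HasSurjectiveModNGaloisRep p := by simpa only [pow_one] using htower 1
  obtain ⟨hℓG, hfrob⟩ :=
    isKolyvaginPrime_and_frobEqFrobInfty_pow_of_zhang W K hK hp2 hM hρ (htower M) hℓ hℓM
  have hgood : (W.baseChange K).HasGoodReductionAt hℓG.place := by
    haveI : hℓG.place.asIdeal.LiesOver (hℓG.place.under (𝓞 ℚ)).asIdeal := ⟨rfl⟩
    exact hasGoodReductionAt_baseChange_of_hasGoodReductionAt_rat W (hℓG.place.under (𝓞 ℚ))
      hℓG.place (LocalFrob.hasGoodReductionAt_rat_of_not_dvd_conductorNorm W hℓG.prime hℓG.2.1 _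
        hℓG.natCast_mem_under)
  obtain ⟨a, b, hab, hmem⟩ := exists_zsmul_add_zsmul_mem_torsionLocalKer_of_eigen_pow W hK hp hp2
    hc hℓG hM (q := p ^ M) rfl hfrob hgood hν
    (((mem_selmerGroup_iff (W.baseChange K) _ s₁).mp hs₁).1 _) hτ₁
    (((mem_selmerGroup_iff (W.baseChange K) _ s₂).mp hs₂).1 _) hτ₂
  refine ⟨a, b, hab, fun v hv ↦ ?_⟩
  have hveq : v = hℓG.place := hℓG.mem_iff.mp hv
  subst hveq
  exact_mod_cast hmem

end Leaf

end Literature.NumberTheory.EllipticCurves.McCallum1991.LeafProofs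

end Part5

/-!
## Part 6 — port of `Summits/BirchSwinnertonDyer/BirchSwinnertonDyer/Theorems/KolyvaginRoadThreePointCertificate.lean` (3 declarations kept)

# The invariance clause of the point-certificate form supplied at Zhang–Kolyvagin levels, and the from one derived-point certificate on a tower of Kolyvagin–Heegner data

Declarations of this Part (verbatim port; each keeps its own docstring and citation): `pow_succ_eq_one_of_dvd_of_inert`, `grAct_traceElt_mem_of_dvd_zhang`, `smul_kolyvaginPoint_sub_mem_of_dvd_zhang`.

Reference keys (see `references.bib` and the declarations' citations): [GrossLMS1991], [WZhang2014], [McCallumLMS1991].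
-/

section Part6

open scoped _root_.Classical
open _root_.WeierstrassCurve _root_.Field _root_.NumberField _root_.IsDedekindDomain _root_.Finset
open Literature.NumberTheory.EllipticCurves Literature.NumberTheory.GaloisRepresentations
open Literature.NumberTheory.EllipticCurves.KolyvaginCocycle
open Literature.NumberTheory.EllipticCurves.KolyvaginEuler
open Literature.NumberTheory.EllipticCurves.RingClassField
open Literature.NumberTheory.EllipticCurves.ModularForms

namespace Literature.NumberTheory.EllipticCurves.McCallum1991.KolyCert

-- `K : Type`: the tree's ring-class class field theory is universe `0`.
variable {K : Type} [Field K] [NumberField K] {N : ℕ} {W : WeierstrassCurve ℚ}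

/-- `σ_m ℓ ^ (ℓ + 1) = 1` for `m ∣ n`, `ℓ ∣ m` (`KolyvaginH44.pow_succ_eq_one_of_dvd` with its
Kolyvagin-prime binder weakened to what the proof uses: the prime factors of `n` are INERT in `K`).
Gross 1991, §3: "`G_ℓ` … cyclic of order `ℓ + 1`". [cite: GrossLMS1991, §3 (chunk 217 L1)] -/
theorem pow_succ_eq_one_of_dvd_of_inert (hK : IsImaginaryQuadratic K) (ι : K →+* ℂ) [NeZero N]
    (Dt : ModularParametrizationData W N) {β : ℤ} {n : ℕ} (hn : Squarefree n)
    (hinert : ∀ q ∈ n.primeFactors, (Ideal.span {(q : 𝓞 K)}).IsPrime)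
    (d : (m : ℕ) → m ∣ n → KolyvaginHeegnerData Dt β ι m)
    {𝒢 : ℕ → Type*} [∀ m, CommGroup (𝒢 m)] (σ : ∀ m, ℕ → 𝒢 m) (L : ℕ → Finset ℕ)
    (ρ : ∀ m, 𝒢 m →* (ringClassField K ι m ≃ₐ[ℚ] ringClassField K ι m))
    (hρ : ∀ m, Function.Injective (ρ m))
    (hσA : ∀ (m : ℕ) (hm : m ∣ n), ∀ q ∈ m.primeFactors, ρ m (σ m q) = (d m hm).σ q)
    (hL : ∀ m : ℕ, m ∣ n → L m = m.primeFactors) :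
    ∀ m : ℕ, m ∣ n → ∀ ℓ ∈ L m, σ m ℓ ^ (ℓ + 1) = 1 := by
  intro m hm ℓ hℓ
  have hm0 : m ≠ 0 := ne_zero_of_dvd_ne_zero hn.ne_zero hm
  rw [hL m hm] at hℓ
  obtain ⟨hℓp, hℓm, -⟩ := Nat.mem_primeFactors.mp hℓ
  have hℓm' : ¬ ℓ ∣ m / ℓ :=
    KolyvaginH44.not_dvd_div_of_squarefree_of_prime (hn.squarefree_of_dvd hm) hℓp hℓm
  have hin := hinert ℓ (Nat.primeFactors_mono hm hn.ne_zero hℓ)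
  have hmem : ρ m (σ m ℓ) ∈ ringClassGalOver ι m (m / ℓ) := by
    rw [hσA m hm ℓ hℓ, ← (d m hm).zpowers_σ ℓ hℓ]
    exact Subgroup.mem_zpowers _
  have h := RingClassTower.pow_succ_eq_one_of_mem_ringClassGalOver hK ι hm0 hℓp hℓm hℓm' hin hmem
  exact hρ m (by rw [map_pow, h, map_one])

/-- **`Tr_ℓ y_m ∈ p^M A₀ m` at the divisors of a square-free product of ZHANG–Kolyvagin primes of index
`≥ M`** (`KolyvaginH44.grAct_traceElt_mem_of_dvd` re-typed): Gross Prop. 3.7 (1)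
`Tr_ℓ y(m) = a_ℓ · y(m/ℓ)↑` (tree THEOREM `HeegnerTrace.sum_pow_pointGalHom_y_eq_lFunction_smul_map`) and
`p^M ∣ a_ℓ` from `M ≤ M(ℓ)` (`Zhang2014.le_kolyvaginIndex_iff`, printed `M(ℓ) = min{v_p(ℓ+1), v_p(a_ℓ)}`),
transferred to `A₀ m` along the equivariant `iA m`. [cite: GrossLMS1991, Prop. 3.7 (1), §3 (3.3)]
[cite: WZhang2014, Notations (xii)] -/
theorem grAct_traceElt_mem_of_dvd_zhang (hK : IsImaginaryQuadratic K) (ι : K →+* ℂ) [NeZero N]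
    [W.IsElliptic] [W.IsGloballyMinimal] (Dt : ModularParametrizationData W N) {β : ℤ} {p M : ℕ}
    (hp : p.Prime) (hND : IsCoprime (N : ℤ) (NumberField.discr K)) (hD : NumberField.discr K < -4)
    {n : ℕ} (hn : Squarefree n)
    (hkol : ∀ q ∈ n.primeFactors,
      Zhang2014.IsKolyvaginPrime N W K p q ∧ M ≤ Zhang2014.kolyvaginIndex W p q)
    (d : (m : ℕ) → m ∣ n → KolyvaginHeegnerData Dt β ι m)
    {𝒢 : ℕ → Type*} [∀ m, CommGroup (𝒢 m)] {A₀ : ℕ → Type*} [∀ m, AddCommGroup (A₀ m)]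
    [∀ m, DistribMulAction (𝒢 m) (A₀ m)]
    (σ : ∀ m, ℕ → 𝒢 m) (L : ℕ → Finset ℕ) (y : ∀ m, A₀ m)
    (ρ : ∀ m, 𝒢 m →* (ringClassField K ι m ≃ₐ[ℚ] ringClassField K ι m))
    (iA : ∀ m, A₀ m ≃+ (W.baseChange (ringClassField K ι m)).toAffine.Point)
    (hiA : ∀ (m : ℕ), m ∣ n → ∀ (g : 𝒢 m) (a : A₀ m),
      iA m (g • a) = pointGalHom W (ringClassField K ι m) (ρ m g) (iA m a))
    (hyA : ∀ (m : ℕ) (hm : m ∣ n), iA m (y m) = (d m hm).y)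
    (hσA : ∀ (m : ℕ) (hm : m ∣ n), ∀ q ∈ m.primeFactors, ρ m (σ m q) = (d m hm).σ q)
    (hL : ∀ m : ℕ, m ∣ n → L m = m.primeFactors) :
    ∀ m : ℕ, m ∣ n → ∀ ℓ ∈ L m,
      grAct (A₀ m) (traceElt (σ m ℓ) ℓ) (y m) ∈ zsmulRange (A₀ m) ((p ^ M : ℕ) : ℤ) := by
  intro m hm ℓ hℓ
  have hn0 := hn.ne_zero
  have hm0 : m ≠ 0 := ne_zero_of_dvd_ne_zero hn0 hm
  rw [hL m hm] at hℓ
  obtain ⟨hℓp, hℓm, -⟩ := Nat.mem_primeFactors.mp hℓ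
  obtain ⟨hℓK, hℓM⟩ := hkol ℓ (Nat.primeFactors_mono hm hn0 hℓ)
  have hℓm' : ¬ ℓ ∣ m / ℓ :=
    KolyvaginH44.not_dvd_div_of_squarefree_of_prime (hn.squarefree_of_dvd hm) hℓp hℓm
  have hm' : m / ℓ ∣ n := (Nat.div_dvd_of_dvd hℓm).trans hm
  have hle : ringClassField K ι (m / ℓ) ≤ ringClassField K ι m :=
    ringClassField_mono hK ι (Nat.div_dvd_of_dvd hℓm) hm0
  have hNm : Nat.Coprime N m := KolyvaginH37Bridge.coprime_of_forall_not_dvd hm0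
    fun q hq => (hkol q (Nat.primeFactors_mono hm hn0 hq)).1.2.1
  haveI : Fact ℓ.Prime := ⟨hℓp⟩
  haveI : Fact p.Prime := ⟨hp⟩
  -- (β2): Gross Prop. 3.7 (1) for the tree's data, in `a_ℓ = W.frobeniusTrace ℓ` currency
  have hgood : W.HasGoodReductionAtPrime ℓ :=
    KolyvaginH37Bridge.hasGoodReductionAtPrime_of_modularParametrizationData Dt hℓK.2.1
  have htr := HeegnerTrace.frobeniusTrace_smul_eq_of_lFunction_smul_eq hgood
    (HeegnerTrace.sum_pow_pointGalHom_y_eq_lFunction_smul_map hK ι hND hℓ hℓK.2.2.2.2.1 hℓK.2.1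
      hℓm' hNm (Or.inr hD) (d m hm) (d (m / ℓ) hm') hle)
  -- (3.3) from Zhang's index: `p^M ∣ a_ℓ`
  have haℓ : ((p ^ M : ℕ) : ℤ) ∣ W.frobeniusTrace ℓ := by
    have h := ((Zhang2014.le_kolyvaginIndex_iff (W := W) (p := p) (M := M) (ℓ := ℓ)).mp hℓM).2
    exact_mod_cast h
  -- transfer to `A₀ m` along the injective equivariant `iA m`
  have hrel : grAct (A₀ m) (traceElt (σ m ℓ) ℓ) (y m) =
      W.frobeniusTrace ℓ • (iA m).symm (WeierstrassCurve.Affine.Point.map (W' := W)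
        ((RingClassField.inclusion ι hle).restrictScalars ℚ) (d (m / ℓ) hm').y) := by
    apply (iA m).injective
    rw [grAct_traceElt, map_sum, map_zsmul, AddEquiv.apply_symm_apply]
    simp_rw [hiA m hm, map_pow (ρ m), hσA m hm ℓ hℓ, hyA m hm]
    exact htr
  exact grAct_traceElt_mem_of_eq_smul hrel haℓ

/-- **McCallum's (4) / Gross's Prop. 3.6 at the divisors of a square-free product of ZHANG–Kolyvagin
primes of index `≥ M`**: `γ P_m − P_m ∈ p^M A₀ m` for every `γ ∈ 𝒢_m`, `m ∣ n`
(`KolyvaginH44.smul_kolyvaginPoint_sub_mem_of_dvd` re-typed; the group-ring identity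
`(σ_ℓ − 1) D_ℓ = ℓ + 1 − Tr_ℓ`, `KolyvaginEuler.smul_kolyvaginPoint_sub_mem`, fed with
`pow_succ_eq_one_of_dvd_of_inert`, `KolyvaginH44.le_closure_of_dvd`, `p^M ∣ ℓ + 1` from Zhang's index and
`grAct_traceElt_mem_of_dvd_zhang`). [cite: GrossLMS1991, Prop. 3.6, §3 (3.5), §4 (4.1)]
[cite: McCallumLMS1991, §4 (4)] -/
theorem smul_kolyvaginPoint_sub_mem_of_dvd_zhang (hK : IsImaginaryQuadratic K) (ι : K →+* ℂ)
    [NeZero N] [W.IsElliptic] [W.IsGloballyMinimal] (Dt : ModularParametrizationData W N) {β : ℤ}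
    {p M : ℕ} (hp : p.Prime)
    (hND : IsCoprime (N : ℤ) (NumberField.discr K)) (hD : NumberField.discr K < -4) {n : ℕ}
    (hn : Squarefree n)
    (hkol : ∀ q ∈ n.primeFactors,
      Zhang2014.IsKolyvaginPrime N W K p q ∧ M ≤ Zhang2014.kolyvaginIndex W p q)
    (d : (m : ℕ) → m ∣ n → KolyvaginHeegnerData Dt β ι m)
    {𝒢 : ℕ → Type*} [∀ m, CommGroup (𝒢 m)] {A₀ : ℕ → Type*} [∀ m, AddCommGroup (A₀ m)]
    [∀ m, DistribMulAction (𝒢 m) (A₀ m)]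
    (σ : ∀ m, ℕ → 𝒢 m) (L : ℕ → Finset ℕ) (H : ∀ m, Subgroup (𝒢 m))
    [∀ m, Fintype (𝒢 m ⧸ H m)] (f : ∀ m, 𝒢 m ⧸ H m → 𝒢 m) (y : ∀ m, A₀ m)
    (ρ : ∀ m, 𝒢 m →* (ringClassField K ι m ≃ₐ[ℚ] ringClassField K ι m))
    (hρ : ∀ m, Function.Injective (ρ m))
    (iA : ∀ m, A₀ m ≃+ (W.baseChange (ringClassField K ι m)).toAffine.Point)
    (hiA : ∀ (m : ℕ), m ∣ n → ∀ (g : 𝒢 m) (a : A₀ m),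
      iA m (g • a) = pointGalHom W (ringClassField K ι m) (ρ m g) (iA m a))
    (hyA : ∀ (m : ℕ) (hm : m ∣ n), iA m (y m) = (d m hm).y)
    (hσA : ∀ (m : ℕ) (hm : m ∣ n), ∀ q ∈ m.primeFactors, ρ m (σ m q) = (d m hm).σ q)
    (hL : ∀ m : ℕ, m ∣ n → L m = m.primeFactors)
    (hfsec : ∀ m : ℕ, m ∣ n → ∀ c : 𝒢 m ⧸ H m, (f m c : 𝒢 m ⧸ H m) = c)
    (hHρ : ∀ m : ℕ, m ∣ n → ∀ h ∈ H m, ρ m h ∈ ringClassGalOver ι m 1) :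
    ∀ m : ℕ, m ∣ n → ∀ γ : 𝒢 m,
      γ • kolyvaginPoint (σ m) (L m) (f m) (y m) - kolyvaginPoint (σ m) (L m) (f m) (y m) ∈
        zsmulRange (A₀ m) ((p ^ M : ℕ) : ℤ) := by
  intro m hm γ
  haveI : Fact p.Prime := ⟨hp⟩
  have hinert : ∀ q ∈ n.primeFactors, (Ideal.span {(q : 𝓞 K)}).IsPrime :=
    fun q hq ↦ (hkol q hq).1.2.2.2.2.1
  have hdvd : ∀ ℓ ∈ L m, ((p ^ M : ℕ) : ℤ) ∣ ((ℓ + 1 : ℕ) : ℤ) := by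
    intro ℓ hℓ
    rw [hL m hm] at hℓ
    obtain ⟨-, hℓM⟩ := hkol ℓ (Nat.primeFactors_mono hm hn.ne_zero hℓ)
    exact Int.natCast_dvd_natCast.mpr
      ((Zhang2014.le_kolyvaginIndex_iff (W := W) (p := p) (M := M) (ℓ := ℓ)).mp hℓM).1
  exact smul_kolyvaginPoint_sub_mem (hfsec m hm)
    (KolyvaginH44.le_closure_of_dvd hK ι Dt hn d σ L H ρ hρ hσA hL hHρ m hm)
    (pow_succ_eq_one_of_dvd_of_inert hK ι Dt hn hinert d σ L ρ hρ hσA hL m hm)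
    hdvd
    (grAct_traceElt_mem_of_dvd_zhang hK ι Dt hp hND hD hn hkol d σ L y ρ iA hiA hyA hσA hL m hm) γ

end Literature.NumberTheory.EllipticCurves.McCallum1991.KolyCert

end Part6

/-!
## Part 7 — port of `Summits/BirchSwinnertonDyer/BirchSwinnertonDyer/Theorems/KolyvaginRoadThreeLevelData.lean` (3 declarations kept)

# Kolyvagin–Heegner data exist at every square-free inert level (`Nonempty (KolyvaginHeegnerData Dt β ι n)` from Gross 1991 §3; `--supports `)

Declarations of this Part (verbatim port; each keeps its own docstring and citation): `ncard_primesOver_eq_one_of_isPrime_span`, `coprime_of_primeFactors_inert`, `nonempty_kolyvaginHeegnerData_of_grossCM`.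

Reference keys (see `references.bib` and the declarations' citations): [GrossLMS1991].
-/

section Part7

open scoped _root_.Classical

universe u

namespace Literature.NumberTheory.EllipticCurves.McCallum1991

open _root_.WeierstrassCurve _root_.NumberField Literature.NumberTheory.EllipticCurves
  Literature.NumberTheory.EllipticCurves.ModularForms

/-- If `(q)` is a prime ideal of `𝓞 K` (`q` a rational prime INERT in `K`), then `(q)` is the only prime of `𝓞 K`
over `qℤ`: the set of primes over `qℤ` has exactly one element. [cite: GrossLMS1991, §3 (3.1)–(3.2)] -/
theorem ncard_primesOver_eq_one_of_isPrime_span {K : Type u} [Field K] [NumberField K] {q : ℕ} (hq : q.Prime)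
    (hP : (Ideal.span {(q : 𝓞 K)}).IsPrime) :
    ((Ideal.span {(q : ℤ)}).primesOver (𝓞 K)).ncard = 1 := by
  set Q : Ideal (𝓞 K) := Ideal.span {(q : 𝓞 K)} with hQ_def
  have hQne : Q ≠ ⊥ := by
    rw [hQ_def, Ne, Ideal.span_singleton_eq_bot]
    exact_mod_cast hq.ne_zero
  have hmax : Q.IsMaximal := hP.isMaximal hQne
  have hunder : Ideal.span {(q : ℤ)} = Q.under ℤ := by
    have hle : Ideal.span {(q : ℤ)} ≤ Q.under ℤ := by
      rw [Ideal.span_le, Set.singleton_subset_iff]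
      show algebraMap ℤ (𝓞 K) q ∈ Q
      rw [map_natCast]
      exact Ideal.subset_span rfl
    have hqmax : (Ideal.span {(q : ℤ)}).IsMaximal :=
      PrincipalIdealRing.isMaximal_of_irreducible (Nat.prime_iff_prime_int.mp hq).irreducible
    exact hqmax.eq_of_le (Ideal.IsPrime.under ℤ Q).ne_top hle
  have hset : (Ideal.span {(q : ℤ)}).primesOver (𝓞 K) = {Q} := by
    ext P
    simp only [Set.mem_singleton_iff]
    constructor
    · rintro ⟨hPp, hover⟩
      have hle : Q ≤ P := by
        rw [hQ_def, Ideal.span_le, Set.singleton_subset_iff]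
        have hmem : (q : ℤ) ∈ P.under ℤ := by
          rw [← hover.over]; exact Ideal.subset_span rfl
        have := Ideal.mem_comap.mp hmem
        simpa using this
      exact (hmax.eq_of_le hPp.ne_top hle).symm
    · intro h
      subst h
      exact ⟨hP, ⟨hunder⟩⟩
  rw [hset, Set.ncard_singleton]

/-- Under the Heegner hypothesis for `N` (every prime factor of `N` SPLITS in `K`), an integer all of whose prime
factors are INERT in `K` is prime to `N` (Gross 1991, (3.1)–(3.2)). [cite: GrossLMS1991, §3 (3.1)–(3.2)] -/
theorem coprime_of_primeFactors_inert {K : Type u} [Field K] [NumberField K] {N n : ℕ}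
    (hH : SatisfiesHeegnerHypothesis N K) (hn : n ≠ 0)
    (hinert : ∀ q ∈ n.primeFactors, (Ideal.span {(q : 𝓞 K)}).IsPrime) : Nat.Coprime n N := by
  refine Nat.coprime_of_dvd fun q hq hqn hqN ↦ ?_
  have hmem : q ∈ n.primeFactors := Nat.mem_primeFactors.mpr ⟨hq, hqn, hn⟩
  have h1 := ncard_primesOver_eq_one_of_isPrime_span hq (hinert q hmem)
  have h2 := hH q hq hqN
  omega

variable {K : Type u} [Field K] [NumberField K] {N : ℕ} [NeZero N] {W : WeierstrassCurve ℚ}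

/-- **Kolyvagin–Heegner data EXIST at every square-free level whose prime factors are inert in `K`**, granted the
two CM facts of Gross 1991 §3 (named facts, hypotheses here): `y(n) = φ(x(n)) ∈ E(K[n])`
(`phi_heegnerPointOfConductor_mem_range_map_ringClassField N W K`) and the cyclicity of each
`G_ℓ = Gal(K[n]/K[n/ℓ])` (`exists_generator_ringClassGalOver K`). The remaining fields are constructed:
`S` := the representatives `Quotient.out` of the cosets of `G_n = Gal(K[n]/K[1])` in `Aut(K[n])` that lie in
`𝒢_n = Gal(K[n]/K)` (a transversal: `K[n]/ℚ` is finite, `finiteDimensional_and_isGalois_ringClassField`);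
`emb := IsAlgClosed.lift : K[n] →ₐ[K] K̄`. For `E/ℚ` elliptic, `K` imaginary quadratic Heegner for `N`, any frame
`(Dt, β, ι)` with `4N ∣ β² − d_K`. (Gross 1991 §3–§4: *"Let `σ_ℓ` be a fixed generator of `G_ℓ` … Let `S` be a
set of coset representatives for `G_n` in `𝒢_n`"*.) CONDITIONAL on the two named facts only.
[cite: GrossLMS1991, §3 (pp. 238–239) and §4 (4.1)] -/
theorem nonempty_kolyvaginHeegnerData_of_grossCM [W.IsElliptic]
    (h1 : phi_heegnerPointOfConductor_mem_range_map_ringClassField N W K)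
    (h2 : exists_generator_ringClassGalOver K)
    (hK : IsImaginaryQuadratic K) (hH : SatisfiesHeegnerHypothesis N K)
    (Dt : ModularParametrizationData W N) (β : ℤ) (ι : K →+* ℂ)
    (hβ : (4 * N : ℤ) ∣ β ^ 2 - NumberField.discr K) {n : ℕ} (hn : Squarefree n)
    (hinert : ∀ q ∈ n.primeFactors, (Ideal.span {(q : 𝓞 K)}).IsPrime) :
    Nonempty (KolyvaginHeegnerData Dt β ι n) := by
  have hn0 : n ≠ 0 := hn.ne_zero
  have hcop : Nat.Coprime n N := coprime_of_primeFactors_inert hH hn0 hinert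
  -- `K[n]/ℚ` is finite: `Aut(K[n])` is finite and `K[n]/K` is algebraic
  obtain ⟨hfd, -⟩ := finiteDimensional_and_isGalois_ringClassField hK ι hn0
  haveI := hfd
  haveI : FiniteDimensional ℚ (ringClassField K ι n) := Module.Finite.trans K (ringClassField K ι n)
  haveI : Algebra.IsAlgebraic K (ringClassField K ι n) := Algebra.IsAlgebraic.of_finite K _
  -- the embedding `K[n] → K̄` over `K`
  let e : ringClassField K ι n →ₐ[K] AlgebraicClosure K := IsAlgClosed.lift
  -- the point `y(n) ∈ E(K[n])` (first named fact)
  obtain ⟨P, hP⟩ := h1 hK hH Dt β ι n hβ hn0 hcop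
  -- the generators `σ_ℓ` (second named fact)
  have hgen : ∀ ℓ ∈ n.primeFactors, ∃ σ : ringClassField K ι n ≃ₐ[ℚ] ringClassField K ι n,
      Subgroup.zpowers σ = ringClassGalOver ι n (n / ℓ) := fun ℓ hℓ ↦
    h2 hK ι n ℓ hn (Nat.prime_of_mem_primeFactors hℓ) (Nat.dvd_of_mem_primeFactors hℓ) (hinert ℓ hℓ)
  choose! σ hσ using hgen
  -- the transversal `S` of `G_n = Gal(K[n]/K[1])` in `𝒢_n = Gal(K[n]/K)`
  set H := ringClassGalOver ι n 1 with hH_def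
  haveI : Finite (_ ⧸ H) := Finite.of_surjective _ (QuotientGroup.mk_surjective (s := H))
  haveI : Fintype (_ ⧸ H) := Fintype.ofFinite _
  let S : Finset (ringClassField K ι n ≃ₐ[ℚ] ringClassField K ι n) :=
    ((Finset.univ : Finset (_ ⧸ H)).image Quotient.out).filter (· ∈ ringClassGal ι n)
  refine ⟨{ dvd_sq_sub := hβ
            y := P
            map_y := hP
            σ := σ
            zpowers_σ := hσ
            S := S
            S_subset := fun s hs ↦ (Finset.mem_filter.mp hs).2
            S_transversal := ?_
            emb := e.toRingHom
            emb_apply := fun k ↦ e.commutes k }⟩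
  intro g hg
  have hHle : H ≤ ringClassGal ι n := ringClassGalOver_le_ringClassGal ι n 1
  -- the representative of the coset `gH`
  set s₀ := ((g : _ ⧸ H)).out with hs₀_def
  have hs₀H : g⁻¹ * s₀ ∈ H := QuotientGroup.eq.mp (QuotientGroup.out_eq' (g : _ ⧸ H)).symm
  have hs₀G : s₀ ∈ ringClassGal ι n := by
    have : s₀ = g * (g⁻¹ * s₀) := by group
    rw [this]
    exact Subgroup.mul_mem _ hg (hHle hs₀H)
  have hs₀S : s₀ ∈ S :=
    Finset.mem_filter.mpr ⟨Finset.mem_image.mpr ⟨(g : _ ⧸ H), Finset.mem_univ _, rfl⟩, hs₀G⟩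
  refine ⟨s₀, ⟨hs₀S, hs₀H⟩, ?_⟩
  rintro s ⟨hsS, hsH⟩
  obtain ⟨q, -, rfl⟩ := Finset.mem_image.mp (Finset.mem_filter.mp hsS).1
  have hgq : (g : _ ⧸ H) = q := by
    rw [← QuotientGroup.out_eq' q]
    exact QuotientGroup.eq.mpr hsH
  rw [hs₀_def, hgq]

end Literature.NumberTheory.EllipticCurves.McCallum1991

end Part7

/-!
## Part 8 — port of `Summits/BirchSwinnertonDyer/Rank1Residual/X11b/KolyvaginHpointsAssembly.lean` (2 declarations kept)

# The points input of `KolyvaginDescent.Kolyvagin1990_sha_primary_finite_of_pointsM_of_reciprocityM`, by per-level choice of Kolyvagin–Heegner data , modulo the cite-only printed inputs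

Declarations of this Part (verbatim port; each keeps its own docstring and citation): `discr_lt_neg_four`, `isCoprime_discr_of_satisfiesHeegnerHypothesis`.

Reference keys (see `references.bib` and the declarations' citations): [McCallumLMS1991].
-/

section Part8

open scoped _root_.Classical
open _root_.WeierstrassCurve _root_.Field _root_.NumberField _root_.IsDedekindDomain _root_.Finset
open Literature.NumberTheory.EllipticCurves Literature.NumberTheory.GaloisRepresentations
open Literature.NumberTheory.EllipticCurves.KolyvaginCocycle
open Literature.NumberTheory.EllipticCurves.KolyvaginEuler
open Literature.NumberTheory.EllipticCurves.RingClassField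
open Literature.NumberTheory.EllipticCurves.ModularForms

namespace Literature.NumberTheory.EllipticCurves.McCallum1991.KolyvaginAssembly

-- `K : Type`: the tree's ring-class class field theory is universe `0`.
variable {K : Type} [Field K] [NumberField K] {N : ℕ} {W : WeierstrassCurve ℚ}

/-- **`d_K ∉ {−3, −4}` forces `d_K < −4`** for an imaginary quadratic `K` (Gross 1991, §1: *"we
assume that `D ≠ 3, 4`"*): `d_K < 0` and `|d_K| > 2` (Minkowski, Mathlib
`NumberField.abs_discr_gt_two`). [cite: McCallumLMS1991, §2–§5 (supporting lemma)] -/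
theorem discr_lt_neg_four (hK : IsImaginaryQuadratic K)
    (hD : NumberField.discr K ≠ -3 ∧ NumberField.discr K ≠ -4) : NumberField.discr K < -4 := by
  have hneg : NumberField.discr K < 0 := hK.discr_neg
  have habs : 2 < |NumberField.discr K| :=
    NumberField.abs_discr_gt_two (by rw [hK.1]; omega)
  rw [abs_of_neg hneg] at habs
  omega

/-- **The Heegner hypothesis gives `(N, d_K) = 1`**: every prime factor of `N` splits in `K`, hence
does not divide `d_K` (`not_dvd_discr_of_satisfiesHeegnerHypothesis`, Dedekind). [cite: McCallumLMS1991, §2–§5 (supporting lemma)] -/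
theorem isCoprime_discr_of_satisfiesHeegnerHypothesis (hK : IsImaginaryQuadratic K)
    (hH : SatisfiesHeegnerHypothesis N K) : IsCoprime (N : ℤ) (NumberField.discr K) := by
  rw [Int.isCoprime_iff_gcd_eq_one, Int.gcd_eq_natAbs, Int.natAbs_natCast]
  refine Nat.Coprime.gcd_eq_one (Nat.coprime_of_dvd fun k hk hkN hkd ↦ ?_)
  exact not_dvd_discr_of_satisfiesHeegnerHypothesis hK hH hk hkN (Int.ofNat_dvd_left.mpr hkd)

end Literature.NumberTheory.EllipticCurves.McCallum1991.KolyvaginAssembly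

end Part8

/-!
## Part 9 — port of `Summits/BirchSwinnertonDyer/BirchSwinnertonDyer/Theorems/Rank1ResidualJetKolyvaginClassSign.lean` (2 declarations kept)

# The sign of the concrete Kolyvagin class under complex conjugation — Gross 1991 Prop. 5.4 `τ c_M(n) = ε_n c_M(n)`, `ε_n = ε · (−1)^{#primes of n}` — at Zhang–Kolyvagin levels (the currency of the road-K cond

Declarations of this Part (verbatim port; each keeps its own docstring and citation): `pointsMap_derivedPoint_concrete_of_prop53_zhang`, `conjAct_kolyvaginClass_eq_sign_smul_zhang`.

Reference keys (see `references.bib` and the declarations' citations): [GrossLMS1991], [McCallumLMS1991], [WZhang2014].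
-/

section Part9

open scoped _root_.Classical
open _root_.WeierstrassCurve _root_.Field _root_.NumberField _root_.IsDedekindDomain _root_.Finset
open Literature.NumberTheory.EllipticCurves Literature.NumberTheory.GaloisRepresentations
open Literature.NumberTheory.EllipticCurves.KolyvaginCocycle Literature.NumberTheory.EllipticCurves.KolyvaginEuler
open Literature.NumberTheory.EllipticCurves.RingClassField Literature.NumberTheory.EllipticCurves.ModularForms
open Literature.NumberTheory.EllipticCurves.McCallum1991
open Literature.NumberTheory.EllipticCurves.McCallum1991.KolyvaginTauEigen

namespace Literature.NumberTheory.EllipticCurves.McCallum1991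

-- `K : Type`: the tree's ring-class class field theory is universe `0`.
variable {K : Type} [Field K] [NumberField K] {N : ℕ} {W : WeierstrassCurve ℚ}

/-- **Gross 1991 Prop. 5.4 (1) for the CONCRETE derived points at ZHANG–Kolyvagin levels**
(`τ P_m = ε_m P_m + p^M B`, `ε_m = ε·(−1)^{#primes of m}`, `B ∈ E(K_m)`):
`KolyvaginTauEigen.pointsMap_derivedPoint_concrete_of_prop53` VERBATIM, with the prime factors of the top
level `n` given as `Zhang2014.IsKolyvaginPrime N W K p q ∧ M ≤ Zhang2014.kolyvaginIndex W p q` instead of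
`IsKolyvaginPrime ∧ FrobEqFrobInfty (p^M)`; the two inputs that used the Frobenius form (McCallum's (4)
`γ P_m − P_m ∈ p^M E(K_m)` and `Tr_ℓ y_m ∈ p^M E(K_m)`, i.e. (β2) + the congruences (3.3)) are taken from
`KolyCert.smul_kolyvaginPoint_sub_mem_of_dvd_zhang` / `KolyCert.grAct_traceElt_mem_of_dvd_zhang`, and
`p^M ∣ ℓ + 1` from `Zhang2014.le_kolyvaginIndex_iff`. CONDITIONAL on `h53` = Gross Prop. 5.3 at the
conductor in printed form (cite-only, not a Literature fact; `KolyvaginA53.h53_of_recM` reduces it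
to Shimura reciprocity at the conductor) and the admissibility `hA` (Gross Lemma 4.3).
[cite: GrossLMS1991, §5 Prop. 5.4 (1) and proof, Prop. 5.3, §3 (τστ⁻¹ = σ⁻¹), (3.3), §4 (4.1), Lemma 4.3]
[cite: McCallumLMS1991, §4 (4)–(5)] [cite: WZhang2014, Notations (xii)] -/
theorem pointsMap_derivedPoint_concrete_of_prop53_zhang [NeZero N] [W.IsElliptic] [W.IsGloballyMinimal]
    (hK : IsImaginaryQuadratic K) (ι : K →+* ℂ)
    {p M : ℕ} (hp : p.Prime) (hM : 1 ≤ M)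
    (Dt : ModularParametrizationData W N) {β : ℤ}
    (hND : IsCoprime (N : ℤ) (NumberField.discr K)) (hD : NumberField.discr K < -4)
    {n : ℕ} (hn : Squarefree n)
    (hkol : ∀ q ∈ n.primeFactors,
      Zhang2014.IsKolyvaginPrime N W K p q ∧ M ≤ Zhang2014.kolyvaginIndex W p q)
    (d : (m : ℕ) → m ∣ n → KolyvaginHeegnerData Dt β ι m)
    {c : K ≃ₐ[ℚ] K} (hc : c ≠ 1) {τ : AlgebraicClosure K ≃+* AlgebraicClosure K}
    (hτ : IsLiftOfAut c τ) (ε : ℤ)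
    (h53 : ∀ (m : ℕ) (hm : m ∣ n) (τm : ringClassField K ι m ≃ₐ[ℚ] ringClassField K ι m),
      (∀ x : ringClassField K ι m, ((τm x : ringClassField K ι m) : ℂ) = starRingEnd ℂ x) →
      ∃ σ' ∈ ringClassGal ι m, IsOfFinAddOrder
        (pointGalHom W (ringClassField K ι m) τm (d m hm).y -
          ε • pointGalHom W (ringClassField K ι m) σ' (d m hm).y))
    (hA : ∀ (m : ℕ) (hm : m ∣ n),
      IsAdmissible (absoluteGaloisGroup K) (d m hm).pointsSubgroup ((p ^ M : ℕ) : ℤ)) :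
    ∀ (m : ℕ) (hm : m ∣ n), ∃ B ∈ (d m hm).pointsSubgroup,
      hτ.pointsMap W ((d m hm).toGeomPoints (d m hm).derivedPoint) =
        (ε * (-1) ^ m.primeFactors.card) • (d m hm).toGeomPoints (d m hm).derivedPoint +
          ((p ^ M : ℕ) : ℤ) • B := by
  intro m hm
  haveI : Fact p.Prime := ⟨hp⟩
  have hn0 : n ≠ 0 := Squarefree.ne_zero hn
  have hm0 : m ≠ 0 := ne_zero_of_dvd_ne_zero hn0 hm
  have hinert : ∀ q ∈ n.primeFactors, (Ideal.span {(q : 𝓞 K)}).IsPrime :=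
    fun q hq ↦ (hkol q hq).1.2.2.2.2.1
  -- THE SEAM: level data at every level (`exists_levelData`)
  choose σ H f y π j e hord hj hπρ hfsec hHρ hdict hjunk using
    fun k ↦ KolyvaginH44.exists_levelData (W := W) (Dt := Dt) (β := β) hK ι hn hinert d k
  -- `𝒢_m = ringClassGal ι m`, a finite commutative group acting on `E(K[m])` through `pointGalHom`
  letI hcg : ∀ k, CommGroup (ringClassGal ι k) := fun k ↦
    { (inferInstance : Group (ringClassGal ι k)) with
      mul_comm := fun a b ↦ (KolyvaginH44.isMulCommutative_ringClassGal' hK ι k).is_comm.comm a b }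
  haveI hfin : ∀ k, Finite (ringClassGal ι k) := KolyvaginH44.finite_ringClassGal hK ι
  letI act : ∀ k, DistribMulAction (ringClassGal ι k)
      ((W.baseChange (ringClassField K ι k)).toAffine.Point) := fun k ↦
    DistribMulAction.compHom _ ((pointGalHom W (ringClassField K ι k)).comp (ringClassGal ι k).subtype)
  letI hft : ∀ k, Fintype (ringClassGal ι k ⧸ H k) := fun k ↦ Fintype.ofFinite _
  have hsmul : ∀ (k) (g : ringClassGal ι k) (Q : (W.baseChange (ringClassField K ι k)).toAffine.Point),
      g • Q = pointGalHom W (ringClassField K ι k)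
        (g : ringClassField K ι k ≃ₐ[ℚ] ringClassField K ι k) Q := fun _ _ _ ↦ rfl
  have hmul : ∀ (a b : ringClassField K ι m ≃ₐ[ℚ] ringClassField K ι m)
      (Q : (W.baseChange (ringClassField K ι m)).toAffine.Point),
      pointGalHom W (ringClassField K ι m) (a * b) Q =
        pointGalHom W (ringClassField K ι m) a (pointGalHom W (ringClassField K ι m) b Q) :=
    fun a b Q ↦ by rw [map_mul]; rfl
  -- the inclusion `ρ_m : 𝒢_m ≤ Aut_ℚ(K[m])` (the identity `iA_m` is `AddEquiv.refl`)
  set ρ : ∀ k, ringClassGal ι k →* (ringClassField K ι k ≃ₐ[ℚ] ringClassField K ι k) :=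
    fun k ↦ (ringClassGal ι k).subtype with hρdef
  have hρ : ∀ k, Function.Injective (ρ k) := fun k ↦ (ringClassGal ι k).subtype_injective
  have hyA : ∀ (k : ℕ) (hk : k ∣ n), AddEquiv.refl _ (y k) = (d k hk).y :=
    fun k hk ↦ (hdict k hk).2.1
  have hσA : ∀ (k : ℕ) (hk : k ∣ n), ∀ q ∈ k.primeFactors, ρ k (σ k q) = (d k hk).σ q :=
    fun k hk ↦ (hdict k hk).2.2.1
  -- the abstract Kolyvagin point IS `P(m)` , inside `E(K[m])`
  have hPE : kolyvaginPoint (σ m) m.primeFactors (f m) (y m) = (d m hm).derivedPoint := by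
    obtain ⟨-, hym, hσm, hfS⟩ := hdict m hm
    have hbij := KolyvaginH37Bridge.bijOn_of_section_of_transversal (ρ m) (hρ m)
      (H := H m) (Γ := ringClassGal ι m) (G₁ := ringClassGalOver ι m 1) (hHρ m)
      (S := ((d m hm).S : Set _)) (fun s hs ↦ (d m hm).S_subset s hs)
      (fun s hs ↦ ⟨⟨s, (d m hm).S_subset s hs⟩, rfl⟩) (d m hm).S_transversal (f m) (hfsec m) hfS
    have h := KolyvaginH37Bridge.map_kolyvaginPoint_eq_derivedPoint
      (pointGalHom W (ringClassField K ι m)) (ρ m) (AddMonoidHom.id _) (fun g a ↦ hsmul m g a)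
      (hn.squarefree_of_dvd hm) hσm (f m) hbij (y m)
    rw [AddMonoidHom.id_apply, AddMonoidHom.id_apply, hym] at h
    rw [hym]
    exact h
  -- McCallum's (4): `γ P(m) − P(m) ∈ p^M E(K[m])` for `γ ∈ 𝒢_m`
  have h4 : ∀ γ : ringClassGal ι m,
      γ • kolyvaginPoint (σ m) m.primeFactors (f m) (y m) -
          kolyvaginPoint (σ m) m.primeFactors (f m) (y m) ∈
        zsmulRange ((W.baseChange (ringClassField K ι m)).toAffine.Point) ((p ^ M : ℕ) : ℤ) :=
    KolyCert.smul_kolyvaginPoint_sub_mem_of_dvd_zhang hK ι Dt hp hND hD hn hkol d σ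
      (fun k ↦ k.primeFactors) H f y ρ hρ (fun _ ↦ AddEquiv.refl _)
      (fun k _ g a ↦ hsmul k g a) hyA hσA (fun _ _ ↦ rfl) (fun k _ ↦ hfsec k) (fun k _ ↦ hHρ k)
      m hm
  -- the Euler hypotheses of Prop. 5.4 (1) at level `m`
  have hgen : H m ≤ Subgroup.closure (σ m '' (m.primeFactors : Set ℕ)) :=
    KolyvaginH44.le_closure_of_dvd hK ι Dt hn d σ (fun k ↦ k.primeFactors) H ρ hρ hσA
      (fun _ _ ↦ rfl) (fun k _ ↦ hHρ k) m hm
  have hdvd : ∀ ℓ ∈ m.primeFactors, ((p ^ M : ℕ) : ℤ) ∣ ((ℓ + 1 : ℕ) : ℤ) := by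
    intro ℓ hℓ
    obtain ⟨-, hℓM⟩ := hkol ℓ (Nat.primeFactors_mono hm hn0 hℓ)
    exact Int.natCast_dvd_natCast.mpr (Zhang2014.le_kolyvaginIndex_iff.mp hℓM).1
  have htr : ∀ ℓ ∈ m.primeFactors,
      grAct ((W.baseChange (ringClassField K ι m)).toAffine.Point) (traceElt (σ m ℓ) ℓ) (y m) ∈
        zsmulRange ((W.baseChange (ringClassField K ι m)).toAffine.Point) ((p ^ M : ℕ) : ℤ) :=
    KolyCert.grAct_traceElt_mem_of_dvd_zhang hK ι Dt hp hND hD hn hkol d σ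
      (fun k ↦ k.primeFactors) y ρ (fun _ ↦ AddEquiv.refl _) (fun k _ g a ↦ hsmul k g a) hyA hσA
      (fun _ _ ↦ rfl) m hm
  -- the conjugation automorphism `τ_m` of `K[m]` and the restriction `τ|K[m] = τ_m · h`
  obtain ⟨τm, hτm⟩ := RingClassConj.exists_conj_algEquiv hK ι hm0
  have hτm𝒢 : τm ∉ ringClassGal ι m := RingClassConj.conj_not_mem_ringClassGal hτm hK
  obtain ⟨h, hh𝒢, hres⟩ :=
    RingClassConj.exists_mem_ringClassGal_apply_emb_eq hK hm0 (d m hm) hc hτ hτm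
  -- no `p^M`-torsion in `E(K[m])` (Lemma 4.3, from `hA` along the injective `toGeomPoints`)
  have hX : ∀ a : (W.baseChange (ringClassField K ι m)).toAffine.Point,
      ((p ^ M : ℕ) : ℤ) • a = 0 → a = 0 := by
    intro a ha
    have h0 : (d m hm).toGeomPoints a = 0 := by
      refine (hA m hm).eq_zero_of_zsmul ⟨a, rfl⟩ ?_
      rw [← map_zsmul (d m hm).toGeomPoints, ha, map_zero]
    have h0' : WeierstrassCurve.Affine.Point.map (W' := W) (d m hm).emb.toRatAlgHom a =
        WeierstrassCurve.Affine.Point.map (W' := W) (d m hm).emb.toRatAlgHom 0 := by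
      rw [map_zero]
      exact h0
    exact WeierstrassCurve.Affine.Point.map_injective (W' := W) (d m hm).emb.toRatAlgHom h0'
  -- `T := τ_m` on `E(K[m])` with `hT : T (γ • a) = γ⁻¹ • T a` ⟸ the dihedral law `τ_m γ τ_m⁻¹ = γ⁻¹`
  -- (Gross §3 / §5; `KolyvaginConj.exists_addMonoidHom_map_smul_eq_inv_smul`, by name)
  obtain ⟨T, hTapp', hT⟩ := KolyvaginConj.exists_addMonoidHom_map_smul_eq_inv_smul hK hm0 W (ρ m)
    (fun g ↦ g.2) (AddEquiv.refl _) (fun g a ↦ hsmul m g a) hτm𝒢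
  have hTapp : ∀ P, T P = pointGalHom W (ringClassField K ι m) τm P := fun P ↦ hTapp' P
  -- Prop. 5.3 (A′-53) ⟹ `hτy` in `p^M E(K[m])` currency
  obtain ⟨σ', hσ'𝒢, hford⟩ := h53 m hm τm hτm
  have hτy : T (y m) - ε • (⟨σ', hσ'𝒢⟩ : ringClassGal ι m) • y m ∈
      zsmulRange ((W.baseChange (ringClassField K ι m)).toAffine.Point) ((p ^ M : ℕ) : ℤ) := by
    have hy : y m = (d m hm).y := (hdict m hm).2.1
    rw [hsmul, hTapp, hy]
    exact mem_zsmulRange_of_isOfFinAddOrder hp hM hX hford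
  -- Prop. 5.4 (1), abstract: `τ_m P(m) − ε_m P(m) ∈ p^M E(K[m])`
  have h54 : T (kolyvaginPoint (σ m) m.primeFactors (f m) (y m)) -
        (ε * (-1) ^ m.primeFactors.card) • kolyvaginPoint (σ m) m.primeFactors (f m) (y m) ∈
      zsmulRange ((W.baseChange (ringClassField K ι m)).toAffine.Point) ((p ^ M : ℕ) : ℤ) :=
    conj_kolyvaginPoint_sub_mem (hfsec m) hgen (fun ℓ hℓ ↦ hord m ℓ hℓ) hdvd htr T hT hτy
  -- assemble: `τ · P(m) = (τ_m h) P(m) = τ_m (P(m) + p^M a₁) = ε_m P(m) + p^M (a₂ + τ_m a₁)`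
  obtain ⟨a₁, ha₁⟩ := h4 ⟨h, hh𝒢⟩
  obtain ⟨a₂, ha₂⟩ := h54
  change ((p ^ M : ℕ) : ℤ) • a₁ =
    pointGalHom W (ringClassField K ι m) h (kolyvaginPoint (σ m) m.primeFactors (f m) (y m)) -
      kolyvaginPoint (σ m) m.primeFactors (f m) (y m) at ha₁
  change ((p ^ M : ℕ) : ℤ) • a₂ = _ at ha₂
  rw [hPE] at ha₁ ha₂
  have hg : ∀ x, τ ((d m hm).emb x) = (d m hm).emb ((τm * h) x) := fun x ↦ by
    rw [AlgEquiv.mul_apply]; exact hres x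
  have hmap := RingClassConj.pointsMap_toGeomPoints_eq (d m hm) hτ hg (d m hm).derivedPoint
  refine ⟨(d m hm).toGeomPoints (a₂ + T a₁), ⟨a₂ + T a₁, rfl⟩, ?_⟩
  have hstep : pointGalHom W (ringClassField K ι m) (τm * h) (d m hm).derivedPoint =
      (ε * (-1) ^ m.primeFactors.card) • (d m hm).derivedPoint + ((p ^ M : ℕ) : ℤ) • (a₂ + T a₁) := by
    have h1 : pointGalHom W (ringClassField K ι m) h (d m hm).derivedPoint =
        (d m hm).derivedPoint + ((p ^ M : ℕ) : ℤ) • a₁ := by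
      rw [ha₁]; abel
    have h2 : T (d m hm).derivedPoint =
        (ε * (-1) ^ m.primeFactors.card) • (d m hm).derivedPoint + ((p ^ M : ℕ) : ℤ) • a₂ := by
      rw [ha₂]; abel
    rw [hmul, h1, ← hTapp, map_add, map_zsmul, h2, smul_add]
    abel
  rw [hmap, hstep, map_add, map_zsmul, map_zsmul]

/-- **Gross 1991 Prop. 5.4 (2) for the CONCRETE class at Zhang–Kolyvagin levels: `τ_* c_M(m) = ε_m c_M(m)`
in `H¹(K, E[p^M])`** (`conjAct W c (p^M)`, the action of the non-trivial automorphism `c` of `K`), for a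
family of data at the divisors of a square-free product `n` of Zhang–Kolyvagin primes of index `≥ M`,
modulo `h53` (Gross Prop. 5.3) and the admissibility `hA`. On the admissible/invariant branch this is
the cocycle functoriality `conjAct_kolyvaginClass_eq_smul` (Literature, *"all the maps in (4.2) commute
with Gal(K/ℚ)"*) fed with Prop. 5.4 (1) (`pointsMap_derivedPoint_concrete_of_prop53_zhang`) and the
`τ`-stability of `E(K_m) ⊆ E(K̄)` (`RingClassConj.pointsMap_mem_pointsSubgroup`); on the junk branch both
sides vanish. [cite: GrossLMS1991, §5 Prop. 5.4 (2) and proof] [cite: McCallumLMS1991, §4 (4.2), (6)] -/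
theorem conjAct_kolyvaginClass_eq_sign_smul_zhang [NeZero N] [W.IsElliptic] [W.IsGloballyMinimal]
    (hK : IsImaginaryQuadratic K) (ι : K →+* ℂ)
    {p M : ℕ} (hp : p.Prime) (hM : 1 ≤ M)
    (Dt : ModularParametrizationData W N) {β : ℤ}
    (hND : IsCoprime (N : ℤ) (NumberField.discr K)) (hD : NumberField.discr K < -4)
    {n : ℕ} (hn : Squarefree n)
    (hkol : ∀ q ∈ n.primeFactors,
      Zhang2014.IsKolyvaginPrime N W K p q ∧ M ≤ Zhang2014.kolyvaginIndex W p q)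
    (d : (m : ℕ) → m ∣ n → KolyvaginHeegnerData Dt β ι m)
    {c : K ≃ₐ[ℚ] K} (hc : c ≠ 1) (ε : ℤ)
    (h53 : ∀ (m : ℕ) (hm : m ∣ n) (τm : ringClassField K ι m ≃ₐ[ℚ] ringClassField K ι m),
      (∀ x : ringClassField K ι m, ((τm x : ringClassField K ι m) : ℂ) = starRingEnd ℂ x) →
      ∃ σ' ∈ ringClassGal ι m, IsOfFinAddOrder
        (pointGalHom W (ringClassField K ι m) τm (d m hm).y -
          ε • pointGalHom W (ringClassField K ι m) σ' (d m hm).y))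
    (hA : ∀ (m : ℕ) (hm : m ∣ n),
      IsAdmissible (absoluteGaloisGroup K) (d m hm).pointsSubgroup ((p ^ M : ℕ) : ℤ)) :
    ∀ (m : ℕ) (hm : m ∣ n),
      conjAct W c ((p ^ M : ℕ) : ℤ) ((d m hm).kolyvaginClass hp M) =
        (ε * (-1) ^ m.primeFactors.card) • (d m hm).kolyvaginClass hp M := by
  intro m hm
  have hm0 : m ≠ 0 := ne_zero_of_dvd_ne_zero hn.ne_zero hm
  by_cases h0 : (d m hm).kolyvaginClass hp M = 0
  · rw [h0, map_zero, zsmul_zero]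
  obtain ⟨hA', hP⟩ := (d m hm).kolyvaginClass_ne_zero h0
  have hτ : IsLiftOfAut c (liftAut c) := isLiftOfAut_liftAut c
  obtain ⟨B, hB, hcong⟩ :=
    pointsMap_derivedPoint_concrete_of_prop53_zhang hK ι hp hM Dt hND hD hn hkol d hc hτ ε h53 hA m hm
  rw [(d m hm).kolyvaginClass_of_admissible hp M hA' hP]
  exact conjAct_kolyvaginClass_eq_smul W hτ hA'
    (RingClassConj.pointsMap_mem_pointsSubgroup hK hm0 (d m hm) hτ) hP _ ⟨B, hB, hcong⟩

end Literature.NumberTheory.EllipticCurves.McCallum1991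

end Part9

/-!
## Part 10 — port of `Summits/BirchSwinnertonDyer/Rank1Residual/X11b/KolyvaginProp53OfReciprocity.lean` (1 declarations kept)

# Gross 1991 Prop. 5.3 at conductor `m` — reduced to Shimura reciprocity at conductor `m`; Atkin–Lehner, Manin–Drinfeld and `φ(−τ̄) = conj φ(τ)` from the tree

Declarations of this Part (verbatim port; each keeps its own docstring and citation): `h53_of_recM`.

Reference keys (see `references.bib` and the declarations' citations): [GrossLMS1991], [Gross1984], [Darmon2004], [AtkinLehner1970], [Manin1972].
-/

section Part10

open scoped _root_.Classical _root_.MatrixGroups _root_.ModularForm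
open _root_.CongruenceSubgroup _root_.UpperHalfPlane _root_.Complex ComplexConjugate _root_.NumberField _root_.WeierstrassCurve
open Literature.NumberTheory.EllipticCurves Literature.NumberTheory.EllipticCurves.HeegnerForm
open Literature.NumberTheory.EllipticCurves.ModularForms

namespace Literature.NumberTheory.EllipticCurves.McCallum1991.KolyvaginA53

-- `K : Type`: the tree's ring-class class field theory is universe `0`.
variable {K : Type} [Field K] [NumberField K] {N : ℕ} {W : WeierstrassCurve ℚ}

/-- **Gross 1991, Prop. 5.3 at conductor `m` — (A′-53) — from Shimura reciprocity at conductor `m`**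
(at the conductor `N = N_E`).  For `E = W/ℚ` elliptic with a modular parametrisation `Dt` of level
`N_E`, `K` imaginary quadratic with the Heegner hypothesis, an orientation `β` (`4N ∣ β² − d_K`),
`m ≠ 0` prime to `N`, ANY Kolyvagin–Heegner datum `d` of conductor `m` (`d.y = y(m) ∈ E(K[m])`,
`y(m) ↦ φ(x_m)`) and any automorphism `τ_m` of `K[m]` acting as complex conjugation: **some
`σ′ ∈ 𝒢_m = Gal(K[m]/K)` has `τ_m y(m) − ε σ′ y(m)` of finite order, `ε = −w(E)`** — the printed
*"`y_n^τ = ε · y_n^{σ′} +` (torsion)"* (chunk 220 L11), i.e. the `h53` binder of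
`KolyvaginTauEigen.pointsMap_derivedPoint_concrete_of_prop53` / of
`KolyvaginAssembly.hpoints_of_perLevelChoice` at one `(m, τ_m)`.  CONDITIONAL on EXACTLY `hrecM` =
Shimura reciprocity at conductor `m` (cite-only, NOT a fact, NOT discharged): for every Heegner form
`Q` of level `N` and discriminant `m² d_K` with `B = mβ`, `φ(τ_Q)` is the complex image of
`σ′ • y(m)` for some `σ′ ∈ 𝒢_m`.  Proof = Gross's (chunk 220 L13–L16) on the tree's conductor-`1`
machinery: `J • x_m = w_N • τ_{Q*}` for `Q* = fricke (negB Q_m) = (N, mβ, A_m/N)`;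
`conj φ(x_m) = φ(J • x_m) = φ(w_N τ_{Q*}) = e φ(τ_{Q*}) + φ(0)` (Atkin–Lehner, `e = −w(E)`); `φ(0)`
torsion (Manin–Drinfeld); `E(K[m]) → E(ℂ)` injective.  Nothing booked.
[cite: GrossLMS1991, §5 Prop. 5.3 and proof, (5.2)] [cite: Gross1984, §5]
[cite: Darmon2004, Thm. 3.7, Prop. 3.11] [cite: AtkinLehner1970, Thm. 3]
[cite: Manin1972, Cor. 3.6] -/
theorem h53_of_recM [W.IsElliptic] [NeZero (W.conductorNorm ℤ)]
    (hK : IsImaginaryQuadratic K) (hH : SatisfiesHeegnerHypothesis (W.conductorNorm ℤ) K)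
    (Dt : ModularParametrizationData W (W.conductorNorm ℤ)) {β : ℤ} (ι : K →+* ℂ)
    (hβ : (4 * (W.conductorNorm ℤ : ℕ) : ℤ) ∣ β ^ 2 - NumberField.discr K)
    {m : ℕ} (hm : m ≠ 0) (hmN : m.Coprime (W.conductorNorm ℤ))
    (d : KolyvaginHeegnerData Dt β ι m)
    (hrecM : ∀ Q : ℤ × ℤ × ℤ,
      Q ∈ heegnerForms (W.conductorNorm ℤ) ((m : ℤ) ^ 2 * NumberField.discr K) →
      Q.2.1 = m * β →
      ∃ σ' ∈ ringClassGal ι m,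
        WeierstrassCurve.Affine.Point.map (W' := W) (ringClassField K ι m).subtype.toRatAlgHom
          (pointGalHom W (ringClassField K ι m) σ' d.y) = Dt.φ (heegnerTau Q))
    (τm : ringClassField K ι m ≃ₐ[ℚ] ringClassField K ι m)
    (hτm : ∀ x : ringClassField K ι m, ((τm x : ringClassField K ι m) : ℂ) = starRingEnd ℂ x) :
    ∃ σ' ∈ ringClassGal ι m, IsOfFinAddOrder
      (pointGalHom W (ringClassField K ι m) τm d.y -
        (-W.rootNumber) • pointGalHom W (ringClassField K ι m) σ' d.y) := by
  set N := W.conductorNorm ℤ with hNdef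
  have hD0 : NumberField.discr K < 0 := hK.discr_neg
  have hm0 : (0 : ℤ) < m := by exact_mod_cast Nat.pos_of_ne_zero hm
  have hDm : (m : ℤ) ^ 2 * NumberField.discr K < 0 := mul_neg_of_pos_of_neg (pow_pos hm0 2) hD0
  have hND : ∀ q : ℕ, q.Prime → q ∣ N → ¬ (q : ℤ) ∣ (m : ℤ) ^ 2 * NumberField.discr K := by
    intro q hq hqN hdvd
    have hqZ : Prime (q : ℤ) := Nat.prime_iff_prime_int.mp hq
    rcases hqZ.dvd_or_dvd hdvd with h | h
    · have hqm : q ∣ m := Int.natCast_dvd_natCast.mp (hqZ.dvd_of_dvd_pow h)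
      exact hq.one_lt.ne' (Nat.Coprime.eq_one_of_dvd (Nat.Coprime.coprime_dvd_left hqm hmN) hqN)
    · exact not_dvd_discr_of_satisfiesHeegnerHypothesis hK hH hq hqN h
  -- the forms `Q_m = (A_m, mβ, 1)` (root `x_m`) and its Fricke partner `Q* = fricke (negB Q_m)`
  obtain ⟨hQm, hQmB⟩ := heegnerFormOfConductor_mem_heegnerForms (N := N) hD0 hβ hm
  set Qm := heegnerFormOfConductor (NumberField.discr K) β m with hQmdef
  set Qs := fricke N (HeegnerForm.negB Qm) with hQsdef
  have hQs : Qs ∈ heegnerForms N ((m : ℤ) ^ 2 * NumberField.discr K) :=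
    fricke_mem_heegnerForms hDm hND (negB_mem_heegnerForms hQm)
  have hQsB : Qs.2.1 = m * β := by
    simp [hQsdef, hQmdef, HeegnerForm.negB, fricke, heegnerFormOfConductor]
  have hback : HeegnerForm.negB (fricke N Qs) = Qm := by
    rw [hQsdef, fricke_fricke (by exact_mod_cast NeZero.ne N) (by simpa using hQm.2.2.1),
      HeegnerForm.negB_negB]
  -- `J • x_m = w_N • τ_{Q*}`
  -- `w_N` on `ℍ`, spelled out (no local notation): `glCast (frickeGL N)`
  have hJx : J • heegnerTau Qm =
      ModularForms.glCast (ModularForms.frickeGL N : GL (Fin 2) ℚ) • heegnerTau Qs := by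
    rw [← hback, heegnerTau_negB_fricke hDm hQs, J_smul_J_smul]
  -- Atkin–Lehner (tree): `f ∣ w_N = e f`, `e = ±1`, pointwise Fricke property, `w(E) = -e`
  have hAL : ∀ (N' : ℕ) [NeZero N'],
      IsNewform0.exists_frickeInvolution_eq_smul (N := N') (k := (2 : ℤ)) :=
    fun N' _ ↦ isNewform0_exists_frickeInvolution_eq_smul_two N'
  have hw : frickeInvolution N 2 Dt.f = frickeEigenvalue Dt.f • Dt.f :=
    IsNewform0.frickeInvolution_eq_smul_of (hAL N) Dt.isNewformOf.1
  obtain ⟨e, he⟩ : ∃ e : ℤ, (e : ℂ) = frickeEigenvalue Dt.f := by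
    rcases IsNewform0.frickeEigenvalue_eq_one_or_eq_neg_one_of (hAL N)
      Dt.isNewformOf.1 with h | h
    · exact ⟨1, by rw [h]; norm_num⟩
    · exact ⟨-1, by rw [h]; norm_num⟩
  have hW : IsFrickeEigen N Dt.f (e : ℂ) := by
    rw [he]
    exact isFrickeEigen_of_frickeInvolution_eq_smul N hw
  have hroot : W.rootNumber = -e := by
    have h := rootNumber_eq_neg_frickeEigenvalue
      (IsNewform0.exists_functional_equation_two_of_frickeInvolution_eq_smul
        fun N' _ ↦ IsNewform0.frickeInvolution_eq_smul_of (hAL N'))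
      (fun N' _ ↦ IsNewform0.frickeEigenvalue_eq_one_or_eq_neg_one_of (hAL N'))
      Dt.isNewformOf
    rw [← he] at h
    exact_mod_cast h
  -- Manin–Drinfeld (tree): `φ(0)` is torsion
  have hT : IsOfFinAddOrder Dt.cuspZeroPoint :=
    isOfFinAddOrder_cuspZeroPoint Dt (exists_nsmul_modularSymbol_mem_periodLattice_of_isNewform0
      Dt.isNewformOf.1 Dt.isNewformOf.coeffField_eq_bot)
  -- Shimura reciprocity at conductor `m` for the partner form `Q*` (THE labelled input)
  obtain ⟨σ', hσ', hrec⟩ := hrecM Qs hQs hQsB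
  refine ⟨σ', hσ', ?_⟩
  -- complex coordinates: `τ_m` acts as complex conjugation
  have hy : WeierstrassCurve.Affine.Point.map (W' := W) (ringClassField K ι m).subtype.toRatAlgHom
      d.y = Dt.φ (heegnerTau Qm) := d.map_y
  have hτ : WeierstrassCurve.Affine.Point.map (W' := W) (ringClassField K ι m).subtype.toRatAlgHom
      (pointGalHom W (ringClassField K ι m) τm d.y) = conjPoint W (Dt.φ (heegnerTau Qm)) := by
    have hcomp : (ringClassField K ι m).subtype.toRatAlgHom.comp
        (τm : ringClassField K ι m →ₐ[ℚ] ringClassField K ι m) =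
        conjRatAlgHom.comp (ringClassField K ι m).subtype.toRatAlgHom := by
      apply AlgHom.ext
      intro x
      simpa using hτm x
    rw [pointGalHom_apply, WeierstrassCurve.Affine.Point.map_map, hcomp,
      ← WeierstrassCurve.Affine.Point.map_map, hy]
  -- `conj φ(x_m) − ε φ(τ_{Q*}) = φ(J x_m) − ε φ(τ_{Q*}) = φ(w_N τ_{Q*}) − e φ(τ_{Q*}) = φ(0)`
  have key : WeierstrassCurve.Affine.Point.map (W' := W) (ringClassField K ι m).subtype.toRatAlgHom
      (pointGalHom W (ringClassField K ι m) τm d.y -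
        (-W.rootNumber) • pointGalHom W (ringClassField K ι m) σ' d.y) = Dt.cuspZeroPoint := by
    rw [map_sub, map_zsmul, hτ, hrec, ← φ_J_smul, hJx, φ_frickeGL_smul Dt hW, hroot, neg_neg,
      add_sub_cancel_left]
  obtain ⟨n, hn, hn0⟩ := hT.exists_nsmul_eq_zero
  refine isOfFinAddOrder_iff_nsmul_eq_zero.mpr ⟨n, hn, ?_⟩
  apply WeierstrassCurve.Affine.Point.map_injective (W' := W)
    (f := (ringClassField K ι m).subtype.toRatAlgHom)
  rw [map_nsmul, key, hn0, map_zero]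

end Literature.NumberTheory.EllipticCurves.McCallum1991.KolyvaginA53

end Part10

/-!
## Part 11 — port of `Summits/BirchSwinnertonDyer/Rank1Residual/JET/GrossProp53Kolyvagin.lean` (2 declarations kept)

# Gross 1991 Prop. 5.3 `y_m^τ = ε·y_m^{σ′} + (torsion)`, `ε = −w(E)` — proved by name at every Kolyvagin conductor

Declarations of this Part (verbatim port; each keeps its own docstring and citation): `exists_mem_ringClassGal_isOfFinAddOrder_conj_sub_smul`, `ne_zero_and_coprime_of_isKolyvaginPrime`.

Reference keys (see `references.bib` and the declarations' citations): [GrossLMS1991], [WZhang2014].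
-/

section Part11

open scoped _root_.Classical

open _root_.NumberField _root_.WeierstrassCurve Literature.NumberTheory.EllipticCurves
  Literature.NumberTheory.EllipticCurves.ModularForms Literature.NumberTheory.EllipticCurves.McCallum1991

namespace Literature.NumberTheory.EllipticCurves.McCallum1991

variable {K : Type} [Field K] [NumberField K]

/-- **Gross 1991, Prop. 5.3, UNCONDITIONAL at a conductor `m ≠ 0` prime to `N`**: for `E/ℚ` of
conductor `N` with a modular parametrisation datum `Dt`, `K` imaginary quadratic with the Heegner
hypothesis for `N`, a Kolyvagin–Heegner datum `d` of conductor `m` (`y(m) ∈ E(K[m])`) and complex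
conjugation `τm` on `K[m] ⊂ ℂ`: `τm·y(m) − ε·σ′·y(m)` has finite order for some `σ′ ∈ 𝒢_m = Gal(K[m]/K)`,
with `ε = −w(E)`.  Proof = `KolyvaginA53.h53_of_recM` fed with
`exists_mem_ringClassGal_map_pointGalHom_y_eq_of_heegnerHypothesis` (Shimura reciprocity at conductor
`m`, Literature). [cite: GrossLMS1991, §5 Prop. 5.3 (p. 243); §3 p. 238 «n ≥ 1 … prime to N»] -/
theorem exists_mem_ringClassGal_isOfFinAddOrder_conj_sub_smul (W : WeierstrassCurve ℚ)
    [W.IsElliptic] [NeZero (W.conductorNorm ℤ)]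
    (hK : IsImaginaryQuadratic K) (hH : SatisfiesHeegnerHypothesis (W.conductorNorm ℤ) K)
    (Dt : ModularParametrizationData W (W.conductorNorm ℤ)) {β : ℤ} (ι : K →+* ℂ)
    {m : ℕ} (hm : m ≠ 0) (hmN : m.Coprime (W.conductorNorm ℤ))
    (d : KolyvaginHeegnerData Dt β ι m)
    (τm : ringClassField K ι m ≃ₐ[ℚ] ringClassField K ι m)
    (hτm : ∀ x : ringClassField K ι m, ((τm x : ringClassField K ι m) : ℂ) = starRingEnd ℂ x) :
    ∃ σ' ∈ ringClassGal ι m, IsOfFinAddOrder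
      (pointGalHom W (ringClassField K ι m) τm d.y -
        (-W.rootNumber) • pointGalHom W (ringClassField K ι m) σ' d.y) :=
  KolyvaginA53.h53_of_recM hK hH Dt ι d.dvd_sq_sub hm hmN d
    (fun _ hQ hQβ ↦ exists_mem_ringClassGal_map_pointGalHom_y_eq_of_heegnerHypothesis
      hK ι hH Dt hm hmN d hQ hQβ) τm hτm

/-- A square-free `m` all of whose prime factors are Kolyvagin primes for `(N, p)` (Zhang 2014,
Notations (xii): `ℓ ∤ N`, …) is `≠ 0` and prime to `N` — the printed scope of Gross §3 (3.1).
[cite: WZhang2014, Notations (xii)] [cite: GrossLMS1991, §3 (3.1)] -/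
theorem ne_zero_and_coprime_of_isKolyvaginPrime {N : ℕ} {W : WeierstrassCurve ℚ}
    [W.IsGloballyMinimal] {p m : ℕ} (hm : Squarefree m)
    (hq : ∀ q ∈ m.primeFactors, Zhang2014.IsKolyvaginPrime N W K p q) :
    m ≠ 0 ∧ m.Coprime N := by
  refine ⟨hm.ne_zero, Nat.Coprime.symm <| Nat.coprime_of_dvd fun q hq' hqN hqm ↦ ?_⟩
  have hmem : q ∈ m.primeFactors := Nat.mem_primeFactors.mpr ⟨hq', hqm, hm.ne_zero⟩
  exact (hq q hmem).2.1 hqN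

end Literature.NumberTheory.EllipticCurves.McCallum1991

end Part11

/-!
## Part 12 — port of `Summits/BirchSwinnertonDyer/Rank1Residual/JET/KolyvaginClassSignUnconditional.lean` (1 declarations kept)

# The sign of the concrete Kolyvagin class under complex conjugation, `τ_* c_k(c) = −w(E)·(−1)^{#primes of c} · c_k(c)` (Gross 1991 Prop. 5.4 (1)) — unconditional

Declarations of this Part (verbatim port; each keeps its own docstring and citation): `sign_conjAct_kolyvaginClass`.

Reference keys (see `references.bib` and the declarations' citations): [GrossLMS1991], [Jetchev2008].
-/

section Part12

open scoped _root_.Classical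
open _root_.WeierstrassCurve _root_.Field _root_.NumberField _root_.IsDedekindDomain _root_.Finset
open Literature.NumberTheory.EllipticCurves Literature.NumberTheory.GaloisRepresentations
open Literature.NumberTheory.EllipticCurves.KolyvaginCocycle Literature.NumberTheory.EllipticCurves.KolyvaginEuler
open Literature.NumberTheory.EllipticCurves.RingClassField Literature.NumberTheory.EllipticCurves.ModularForms
open Literature.NumberTheory.EllipticCurves.McCallum1991
open Literature.NumberTheory.EllipticCurves.McCallum1991.KolyvaginTauEigen

namespace Literature.NumberTheory.EllipticCurves.McCallum1991

variable {K : Type} [Field K] [NumberField K] {W : WeierstrassCurve ℚ}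

/-- **Gross 1991 Prop. 5.4 (1) for the concrete class, UNCONDITIONAL**: for `E/ℚ` globally minimal with
`ρ̄_{E,p}` onto at an odd `p`, `K` imaginary quadratic with `d_K ∉ {−3, −4}` and the Heegner hypothesis
for `N = N_E`, the non-trivial `τ ∈ Aut(K/ℚ)`, a frame `(Dt, β, ι)`, a square-free conductor `c` all of
whose prime factors are Kolyvagin primes of index `≥ k ≥ 1`, and ANY datum `d` of conductor `c`:
`τ_* c_k(c) = e • c_k(c)` with `e = −w(E)·(−1)^{#primes of c} ∈ {±1}` — the output of
`exists_sign_conjAct_kolyvaginClass_of_prop53` at `ε = −w(E)` with its three named inputs discharged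
(`…_holds` ×2, Prop. 5.3 by `exists_mem_ringClassGal_isOfFinAddOrder_conj_sub_smul` at every divisor of `c`).
[cite: GrossLMS1991, §5 Prop. 5.3, Prop. 5.4 (1) (p. 243)] [cite: Jetchev2008, §4.1.3 (ε(c))] -/
theorem sign_conjAct_kolyvaginClass_unconditional [W.IsElliptic] [W.IsGloballyMinimal] [NeZero (W.conductorNorm ℤ)]
    (hK : IsImaginaryQuadratic K) (hD3 : NumberField.discr K ≠ -3) (hD4 : NumberField.discr K ≠ -4)
    (hH : SatisfiesHeegnerHypothesis (W.conductorNorm ℤ) K)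
    {p : ℕ} [Fact p.Prime] (hp2 : p ≠ 2) (hρ : W.HasSurjectiveModNGaloisRep p)
    (τ : K ≃ₐ[ℚ] K) (hτ : τ ≠ 1)
    (Dt : ModularParametrizationData W (W.conductorNorm ℤ)) (β : ℤ) (ι : K →+* ℂ)
    {c : ℕ} (hc : Squarefree c) {k : ℕ} (hk : 1 ≤ k)
    (hcK : ∀ ℓ ∈ c.primeFactors, Zhang2014.IsKolyvaginPrime (W.conductorNorm ℤ) W K p ℓ ∧
      k ≤ Zhang2014.kolyvaginIndex W p ℓ)
    (d : KolyvaginHeegnerData Dt β ι c) :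
    (-W.rootNumber * (-1) ^ c.primeFactors.card = 1 ∨ -W.rootNumber * (-1) ^ c.primeFactors.card = -1) ∧
      conjAct W τ ((p ^ k : ℕ) : ℤ) (d.kolyvaginClass (Fact.out : p.Prime) k) =
        (-W.rootNumber * (-1) ^ c.primeFactors.card) • d.kolyvaginClass (Fact.out : p.Prime) k := by
  have hp : p.Prime := Fact.out
  have hCM1 : phi_heegnerPointOfConductor_mem_range_map_ringClassField (W.conductorNorm ℤ) W K :=
    phi_heegnerPointOfConductor_mem_range_map_ringClassField_holds (W.conductorNorm ℤ) W K
  have hCM2 : exists_generator_ringClassGalOver K := exists_generator_ringClassGalOver_holds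
  have hND : IsCoprime (W.conductorNorm ℤ : ℤ) (NumberField.discr K) :=
    KolyvaginAssembly.isCoprime_discr_of_satisfiesHeegnerHypothesis hK hH
  have hD : NumberField.discr K < -4 := KolyvaginAssembly.discr_lt_neg_four hK ⟨hD3, hD4⟩
  have hinert : ∀ (m' : ℕ), m' ∣ c → ∀ q ∈ m'.primeFactors, (Ideal.span {(q : 𝓞 K)}).IsPrime :=
    fun m' hm' q hq ↦ (hcK q (Nat.primeFactors_mono hm' hc.ne_zero hq)).1.2.2.2.2.1
  -- data at every divisor of `c` (the given `d` at `c` itself)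
  have hne : ∀ m' : ℕ, m' ∣ c → Nonempty (KolyvaginHeegnerData Dt β ι m') := fun m' hm' ↦
    Literature.NumberTheory.EllipticCurves.McCallum1991.nonempty_kolyvaginHeegnerData_of_grossCM hCM1 hCM2 hK hH Dt β ι
      d.dvd_sq_sub (hc.squarefree_of_dvd hm') (hinert m' hm')
  let data : (m' : ℕ) → m' ∣ c → KolyvaginHeegnerData Dt β ι m' := fun m' hm' ↦
    if h : m' = c then h ▸ d else (hne m' hm').some
  have hdata : data c dvd_rfl = d := by simp [data]
  -- Gross Prop. 5.3 at every divisor of `c` (all `≠ 0` and prime to `N`), UNCONDITIONALLY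
  have h53 : ∀ (m : ℕ) (hm : m ∣ c) (τm : ringClassField K ι m ≃ₐ[ℚ] ringClassField K ι m),
      (∀ x : ringClassField K ι m, ((τm x : ringClassField K ι m) : ℂ) = starRingEnd ℂ x) →
      ∃ σ' ∈ ringClassGal ι m, IsOfFinAddOrder
        (pointGalHom W (ringClassField K ι m) τm (data m hm).y -
          (-W.rootNumber) • pointGalHom W (ringClassField K ι m) σ' (data m hm).y) := by
    intro m hm τm hτm
    obtain ⟨hm0, hmN⟩ := ne_zero_and_coprime_of_isKolyvaginPrime (K := K) (hc.squarefree_of_dvd hm)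
      (fun q hq ↦ (hcK q (Nat.primeFactors_mono hm hc.ne_zero hq)).1)
    exact exists_mem_ringClassGal_isOfFinAddOrder_conj_sub_smul W hK hH Dt ι hm0 hmN (data m hm) τm hτm
  refine ⟨?_, ?_⟩
  · rcases W.rootNumber_eq_one_or with h1 | h1 <;>
      rcases neg_one_pow_eq_or ℤ c.primeFactors.card with h | h <;> simp [h1, h]
  · have h := conjAct_kolyvaginClass_eq_sign_smul_zhang (c := τ) hK ι hp hk Dt hND hD hc hcK data hτ
      (-W.rootNumber) h53
      (fun m hm ↦ RingClassNoTorsion.isAdmissible_pointsSubgroup _ hK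
        (ne_zero_of_dvd_ne_zero hc.ne_zero hm) hp hp2 hρ k) c dvd_rfl
    rwa [hdata] at h

end Literature.NumberTheory.EllipticCurves.McCallum1991

end Part12

/-!
## Part 13 — port of `Summits/BirchSwinnertonDyer/BirchSwinnertonDyer/Theorems/KolyvaginDepthDoorKolyvaginDepthSupplyLeafSign.lean` (2 declarations kept)

# The sign law `McCallum1991.sign_conjAct_kolyvaginClass` (Gross 1991 Prop. 5.4 (2) / McCallum 1991 §5) holds, unconditionally

Declarations of this Part (verbatim port; each keeps its own docstring and citation): `sign_conjAct_kolyvaginClass_rootNumber`, `sign_conjAct_kolyvaginClass_holds`.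

Reference keys (see `references.bib` and the declarations' citations): [GrossLMS1991], [WZhang2014], [McCallumLMS1991].
-/

section Part13

open scoped _root_.Classical

namespace Literature.NumberTheory.EllipticCurves.McCallum1991.LeafProofs

open Literature.NumberTheory.EllipticCurves Literature.NumberTheory.EllipticCurves.ModularForms
  Literature.NumberTheory.EllipticCurves.McCallum1991 _root_.WeierstrassCurve _root_.NumberField

/-- **The sign law with the sign named: `τ_* c_M(n) = (−w(E))·(−1)^{ν(n)} · c_M(n)`** for the
concrete class of ANY datum `d` of square-free conductor `n` whose prime factors are Zhang–Kolyvagin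
primes of index `≥ M ≥ 1`, `E/ℚ` globally minimal with `ρ̄_{E,p}` onto at an odd `p`, `K` imaginary
quadratic with `d_K ∉ {−3, −4}` and the Heegner hypothesis for `N_E`, `c` the non-trivial element of
`Aut(K/ℚ)` — the tree theorem `sign_conjAct_kolyvaginClass` (Gross 1991 Prop. 5.4 (1) for the
concrete class, unconditional), re-exported in this route's namespace.
[cite: GrossLMS1991, §5 Prop. 5.3, Prop. 5.4 (p. 243)] [cite: WZhang2014, Notations (xii)] -/
theorem sign_conjAct_kolyvaginClass_rootNumber
    (W : WeierstrassCurve ℚ) [W.IsElliptic] [W.IsGloballyMinimal] [NeZero (W.conductorNorm ℤ)]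
    (K : Type) [Field K] [NumberField K] (hK : IsImaginaryQuadratic K)
    (hD3 : NumberField.discr K ≠ -3) (hD4 : NumberField.discr K ≠ -4)
    (hH : SatisfiesHeegnerHypothesis (W.conductorNorm ℤ) K)
    (p : ℕ) [Fact p.Prime] (hp2 : p ≠ 2) (hρ : W.HasSurjectiveModNGaloisRep p)
    (c : K ≃ₐ[ℚ] K) (hc : c ≠ 1)
    (Dt : ModularParametrizationData W (W.conductorNorm ℤ)) (β : ℤ) (ι : K →+* ℂ)
    {M : ℕ} (hM : 1 ≤ M) {n : ℕ} (hn : Squarefree n)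
    (hk : ∀ l' ∈ n.primeFactors, Zhang2014.IsKolyvaginPrime (W.conductorNorm ℤ) W K p l' ∧
      M ≤ Zhang2014.kolyvaginIndex W p l')
    (d : KolyvaginHeegnerData Dt β ι n) :
    conjAct W c ((p ^ M : ℕ) : ℤ) (d.kolyvaginClass (Fact.out : p.Prime) M) =
      (-W.rootNumber * (-1) ^ n.primeFactors.card) • d.kolyvaginClass (Fact.out : p.Prime) M :=
  (Literature.NumberTheory.EllipticCurves.McCallum1991.sign_conjAct_kolyvaginClass_unconditional hK hD3 hD4 hH hp2 hρ c hc
    Dt β ι hn hM hk d).2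

/-- **LEAF 1 DISCHARGED: `McCallum1991.sign_conjAct_kolyvaginClass` HOLDS** (Gross 1991 Prop. 5.4 (2)
/ McCallum 1991 §5: the class `c_M(n)` lies in the `ε(−1)^{ν(n)}`-eigenspace of complex conjugation,
ONE sign `ε = ±1` for the curve — here `ε = −w(E)`). Proof: the tree theorem
`sign_conjAct_kolyvaginClass` at every square-free Zhang–Kolyvagin level, the leaf's tower
surjectivity read at `n = 1`. Unconditional; the leaf's `¬ CM` binder is idle.
[cite: GrossLMS1991, §5 Prop. 5.4 (2) (p. 243)] [cite: McCallumLMS1991, §5 (p. 303)] -/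
theorem _root_.Literature.NumberTheory.EllipticCurves.McCallum1991.sign_conjAct_kolyvaginClass_holds : sign_conjAct_kolyvaginClass := by
  intro W _ _ _ _hcm K _ _ hK hD3 hD4 hH p _ hp2 htower c hc Dt β ι M hM
  have hρ : W.HasSurjectiveModNGaloisRep p := by simpa only [pow_one] using htower 1
  refine ⟨-W.rootNumber, ?_, fun n hn hk d ↦
    sign_conjAct_kolyvaginClass_rootNumber W K hK hD3 hD4 hH p hp2 hρ c hc Dt β ι hM hn hk d⟩
  rcases W.rootNumber_eq_one_or with h | h <;> simp [h]

end Literature.NumberTheory.EllipticCurves.McCallum1991.LeafProofs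

end Part13

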